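import Summits.AtomisticToContinuum.Crystallization.Theses.DisclinationRation
import Summits.AtomisticToContinuum.Crystallization.Theorems.PhononStability.Negative.Mirror
import Summits.AtomisticToContinuum.Crystallization.Theorems.UniformPolytypeStability.Negative.Membrane
import Mathlib.Analysis.Normed.Group.Tannery

/-!
# Disproof workfile for crux `UniformPolytypeStability` (stmt-AtomisticToContinuum-15800)

Standing adversary: refuter-cdisprove-stmt-AtomisticToContinuum-15800-0 (route `DisclinationRation`,
crux K4 / rank 5: ONE `κ > 0` such that for every `a ∈ [47/50, 1]`, every Hägg word `s`, every
height sequence `z` with increments in `[39a/50, 17a/20]` whose layered set `L(a,s,z)` is in exact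
LJ force balance, `κ·Σ_{|p−q|≤11/10}‖u_p−u_q‖² ≤ ½Σ_{p≠q}(u_p−u_q)ᵀK(p−q)(u_p−u_q)` for all
finitely supported `u`).

FINDINGS (index).  LANDED (ACCEPTED) under `Theorems/UniformPolytypeStability/Negative/`:
`Mirror.lean` (part I, p169164), `Rows.lean` (part II, p170450), `Membrane.lean` (part III′ planar
estimate, p170285), `WithoutUpperA.lean` (part III, p170793), `HeightUpper.lean` (part III′,
p170798), `HaggLattice.lean` (part V′-a, p170816), `WithoutHagg.lean` (part V′-b, p171319),
`SquashedLattice.lean` (part V″-a, p171326); SUBMITTED (review queue): `HeightLower.lean` (part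
V″-b, p171610).  All rc 0 / 0 warnings / standard axioms against the tree.  Parts I–III′, V′, V″ below are byte-identical (up to the namespace and one inlined helper)
to those files; parts IV–V are workfile-only.  LOAD-BEARING SCORECARD of the crux's
six hypotheses: `a ≤ 1` PROVED necessary (III); upper height bound PROVED necessary (III′);
`IsHaggSeq s` PROVED necessary (V′); LOWER height bound PROVED necessary (V″, squashed fcc
`h = 1/10`); lower bound `47/50 ≤ a` and `ForceBalanced` are NOT necessary for truth numerically
(min ratio 0.1535 > 0 without force balance; part IV).  So FOUR of the six hypotheses are
load-bearing with kernel-checked witnesses, and the remaining two are (numerically) droppable.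
* Part I (Mirror) — named copies of the crux's `let`s and hypotheses (`Sites`, `HeightBox`,
  `ForceBalanced`, `nnForm`, `hessForm`; `Hess₀` = landed `PhononStabilityNegative.Hess₀`),
  `uniformPolytypeStability_iff` (`Iff.rfl`), the window form `UniformPolytypeStabilityOn W`
  (crux ⟺ `W = Box`).  READ-BACK: the statement elaborates (W.lean rc 0) and reads as intended —
  `haggLabel` is the INTEGER label but `3w ∈ Λ`, so `Sites` is the genuine Barlow stacking; `deriv`,
  `deriv∘deriv` of `lennardJones` are the true `V′, V″` on `r > 0`; all `tsum`s are honest for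
  finitely supported `u` (rows `O(r⁻⁸)`); NN shell (in-layer `a ∈ [.94,1]`, interlayer
  `√(a²/3+h²) ∈ [.912,1.028]`) below the cutoff `11/10` below the second shell (`≥ 1.33`).
  NO typing junk found.
  STRUCTURAL FACT (`sites_const_zU`, `forceBalanced_of_sites_eq`, PROVED): force balance does NOT
  pin the layer spacing — the fcc word at ANY uniform gap `h` (and the hcp word, by the basal
  mirror; numerically every tested word at uniform gaps to `1e-13`) is force balanced for every
  `(a,h)`.  So the family contains the full 2-parameter homogeneous-strain box
  `a ∈ [.94, 1] × h/a ∈ [.78, .85]` (in-plane `±3.1 %` about `a* = 0.9712`, c-axis `−4.5 … +4.1 %`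
  about the ideal ratio), not only "in-plane prestress" as the crux's risk note says; for a general
  word force balance fixes only the RELATIVE gaps (modulation `< 1e-4·a` numerically).
* Part II (Rows) — reindexing of the double `tsum`s by a lattice and the exact row structure of a
  single-site displacement: `hessForm(ξ·𝟙₀) = 2Σ'_{y≠0} ξᵀK(y)ξ` (PROVED).
* Part III (WithoutUpperA) — **`a ≤ 1` is load-bearing**:
  `uniformPolytypeStability_false_without_upperA : ¬ UniformPolytypeStabilityOn (47/50 ≤ a ∧
  IsHaggSeq s ∧ HeightBox a z)` — dilation witness `a → ∞`, fcc word, `u = eᵢ𝟙₀`, exact scaling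
  `Σ'H = a⁻⁸S₈ + a⁻¹⁴S₁₄` and the pigeonhole `Σᵢ S₈(eᵢ) = −5Σ'|x|⁻⁸ < 0` (no lattice-sum
  numerics).  PROVED (std axioms).  (Numerically, j026943/B4: `S₈(e₁) = S₈(e₂) = −21.876`,
  `S₈(e₃) = −23.908`, `S₁₄ = 46.37 / 53.72`; the single-site witness turns negative at
  `a = 1.133 / 1.144` — far beyond the true elastic edge `a ≈ 1.056`, which needs extended modes.)
* Part III′ (Membrane + HeightUpper) — **the upper height bound `z(m+1) − z(m) ≤ 17a/20` is
  load-bearing**: `uniformPolytypeStability_false_without_heightUpper : ¬ UniformPolytypeStabilityOn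
  (47/50 ≤ a ∧ a ≤ 1 ∧ IsHaggSeq s ∧ ∀ m, 39a/50 ≤ z(m+1) − z(m))` — witness `a = 47/50`, fcc word,
  uniform gap `H → ∞` (Tannery over the lattice), `u = e₃𝟙₀`: the basal layer is a COMPRESSED
  triangular LJ membrane with transverse stiffness `Σ_{η≠0}V′(|η|)/|η| < −3/2` (`6·(−0.7375)`
  exact + tail `≤ 2.597` by a block + strip majorant with `ζ(4)`, `π < 3.15`; true value `−4.261`).
  PROVED (std axioms).
* Part IV (numerics, comments) — the crux itself RESISTS: Bloch pencil `λ_gen(D(k), 2N(k))` over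
  the box for fcc/hcp/dhcp/6H/9R/15R/twin/random words (force-balanced gaps) has
  `min = 0.181 > 0`, attained by fcc at the ALL-TENSILE CORNER `(a, h) = (1, 0.85a)` on the
  long-wave quasi-transverse acoustic branch; relaxed cell `0.465`.  WITHOUT force balance (ALL
  `2^N` gap patterns in `{.78a,.85a}^N`, `N ≤ 6`, words fcc/hcp/mixed, `a ∈ {.94,.97,1}`, job
  j026943) the minimum only drops to `0.1535` (hcp word, alternating gaps, `a = 1`; fcc `.1571`):
  force balance is NOT needed for truth, only for the constant.  TIGHTNESS: instability at
  `h/a ≈ 0.915` (`a = 1`), `a ≈ 1.056` (`h = .85a`), `h/a ≈ 0.69` (`a = .94`): the box's upper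
  edges are within `≈ 6 %` of a genuine elastic instability, the lower edges `≥ 11 %` away.
* Part V′ (HaggLattice + WithoutHagg) — **`IsHaggSeq s` is load-bearing**:
  `uniformPolytypeStability_false_without_hagg : ¬ UniformPolytypeStabilityOn (47/50 ≤ a ∧ a ≤ 1 ∧
  HeightBox a z)` — the ZERO word (`haggLabel ≡ 0`, AAA = simple-hexagonal stacking, a Bravais
  lattice hence force balanced) at `a = 47/50`, `h = 39a/50 = .7332`, `u = e₁𝟙₀`: the near field
  `|n|_∞ ≤ 2` of `Σ_{y≠0} e₁ᵀK(y)e₁` is evaluated EXACTLY over `ℚ` by the kernel (`decide +kernel`,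
  124 terms: `< −75.8`; two vertical bonds `2V′(h)/h = −130.19`, six in-plane `+56.08`), the far
  field is `≤ q⁻⁴ ≤` three slab majorants summed with `ζ(2)`, `ζ(4)`, `π < 3.15` (`≤ 21`).
  PROVED (std axioms).  (True value `−75.92`, j026943/B1.)
* Part V″ (HeightLower) — **the lower height bound `39a/50 ≤ z(m+1) − z(m)` is load-bearing**:
  `uniformPolytypeStability_false_without_heightLower : ¬ UniformPolytypeStabilityOn (47/50 ≤ a ∧
  a ≤ 1 ∧ IsHaggSeq s ∧ ∀ m, 0 < z(m+1) − z(m) ≤ 17a/20)` — fcc word at `a = 47/50` with uniform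
  SQUASHED gap `h = 1/10` (force balanced, part I; `hessForm_single_of_summable` replaces the
  separation hypothesis of part II), `u = e₁𝟙₀`: the same-registry layers `m, m±3` are straight
  above each other at distance `3h = 0.3`, tangential prestress `2V′(3h)/(3h)`; near block of 474
  vectors in SHEARED labels `(i,j,m) ↦ iu + jv + l(m)w + mhe₃`, `l(m) ∈ {−1,0,1}`, exact over `ℚ`
  by the kernel (`< −4·10⁷` in `V/12` units), far field `|T| ≤ 8q⁻⁴ ≤` three slab majorants
  (`≤ 10⁶`).  PROVED (std axioms).  (Extended shear modes kill the statement already at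
  `h = 0.66a`, Bloch `−0.60`, part IV; the single-site witness needs `h ≲ 0.15`.)
* Part V (near-misses, `sorry`, workfile only) — the natural enlargements `a ≤ 1.06`, `h ≤ 0.92a`
  are numerically FALSE (extended modes only); `ForceBalanced` conjecturally droppable;
  obstruction to Lean proofs recorded per item.
-/



noncomputable section

namespace Summit.AtomisticToContinuum.Crystallization.Cruxes.UniformPolytypeStability.Disproof

open scoped BigOperators Topology Classical InnerProductSpace
open Filter Set Function
open Literature.MathematicalPhysics.StatisticalMechanics
open Summit.AtomisticToContinuum.Crystallization.Theorems.PhononStabilityNegative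

local notation "E3" => EuclideanSpace ℝ (Fin 3)

/-! ## §0 Mirror of the crux's local objects (verbatim; all unfold definitionally) -/

/-- The layered site set `L(a,s,z)`: triangular layers of spacing `a`, layer `m` in hole registry
`haggLabel s m`, at height `z m` (verbatim the crux's `let Sites`). [folklore] -/
def Sites (a : ℝ) (s : ℤ → ℤ) (z : ℤ → ℝ) : Set E3 :=
  {p | ∃ m i j : ℤ, p = ((i : ℝ) • triangularVec₁ a) + ((j : ℝ) • triangularVec₂ a) +
    ((haggLabel s m : ℝ) • barlowOffset a) + (z m • layerNormal 1)}

/-- The height box: increments in `[39a/50, 17a/20]` (verbatim the crux's hypothesis). [folklore] -/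
def HeightBox (a : ℝ) (z : ℤ → ℝ) : Prop :=
  ∀ m : ℤ, 39 / 50 * a ≤ z (m + 1) - z m ∧ z (m + 1) - z m ≤ 17 / 20 * a

/-- Exact Lennard-Jones force balance of `L(a,s,z)` (verbatim the crux's hypothesis). [folklore] -/
def ForceBalanced (a : ℝ) (s : ℤ → ℤ) (z : ℤ → ℝ) : Prop :=
  ∀ p ∈ Sites a s z, HasSum (fun q : {q : E3 // q ∈ Sites a s z ∧ q ≠ p} =>
    (deriv lennardJones (dist p q.1) / dist p q.1) • (p - q.1)) 0

/-- Nearest-neighbour strain form (the crux's left-hand double `tsum`). [folklore] -/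
def nnForm (a : ℝ) (s : ℤ → ℤ) (z : ℤ → ℝ) (u : E3 → E3) : ℝ :=
  ∑' p : Sites a s z, ∑' q : Sites a s z, if dist (p : E3) q ≤ 11 / 10 then ‖u p - u q‖ ^ 2 else 0

/-- Second-variation double sum (the crux's right-hand double `tsum`, before halving). [folklore] -/
def hessForm (a : ℝ) (s : ℤ → ℤ) (z : ℤ → ℝ) (u : E3 → E3) : ℝ :=
  ∑' p : Sites a s z, ∑' q : Sites a s z,
    if (p : E3) ≠ q then Hess₀ ((p : E3) - q) (u p - u q) else 0

/-- The crux over the named objects (definitional unfolding only). [folklore] -/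
theorem uniformPolytypeStability_iff :
    Summit.AtomisticToContinuum.Crystallization.Theses.DisclinationRation.UniformPolytypeStability ↔
      ∃ κ : ℝ, 0 < κ ∧ ∀ (a : ℝ) (s : ℤ → ℤ) (z : ℤ → ℝ), 47 / 50 ≤ a → a ≤ 1 → IsHaggSeq s →
        HeightBox a z → ForceBalanced a s z →
        ∀ u : E3 → E3, (Function.support u).Finite → Function.support u ⊆ Sites a s z →
          κ * nnForm a s z u ≤ hessForm a s z u / 2 :=
  Iff.rfl

/-! ## §1 The window form (the mutated statements drop one conjunct of `Box`) -/

/-- **Uniform polytype stability on a window predicate** `W a s z` replacing the crux's four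
geometric hypotheses `47/50 ≤ a`, `a ≤ 1`, `IsHaggSeq s`, `HeightBox a z` (force balance is kept).
[folklore] -/
def UniformPolytypeStabilityOn (W : ℝ → (ℤ → ℤ) → (ℤ → ℝ) → Prop) : Prop :=
  ∃ κ : ℝ, 0 < κ ∧ ∀ (a : ℝ) (s : ℤ → ℤ) (z : ℤ → ℝ), W a s z → ForceBalanced a s z →
    ∀ u : E3 → E3, (Function.support u).Finite → Function.support u ⊆ Sites a s z →
      κ * nnForm a s z u ≤ hessForm a s z u / 2

/-- The crux's window: `47/50 ≤ a ≤ 1`, `s` a Hägg word, increments of `z` in `[39a/50, 17a/20]`.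
[folklore] -/
def Box (a : ℝ) (s : ℤ → ℤ) (z : ℤ → ℝ) : Prop :=
  47 / 50 ≤ a ∧ a ≤ 1 ∧ IsHaggSeq s ∧ HeightBox a z

/-- The crux is stability on the window `Box`. [folklore] -/
theorem uniformPolytypeStability_iff_on :
    Summit.AtomisticToContinuum.Crystallization.Theses.DisclinationRation.UniformPolytypeStability ↔
      UniformPolytypeStabilityOn Box := by
  rw [uniformPolytypeStability_iff]
  unfold UniformPolytypeStabilityOn Box
  constructor
  · rintro ⟨κ, hκ, h⟩
    exact ⟨κ, hκ, fun a s z hW hF => h a s z hW.1 hW.2.1 hW.2.2.1 hW.2.2.2 hF⟩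
  · rintro ⟨κ, hκ, h⟩
    exact ⟨κ, hκ, fun a s z h₁ h₂ h₃ h₄ hF => h a s z ⟨h₁, h₂, h₃, h₄⟩ hF⟩

/-- Stability on a window passes to smaller windows. [folklore] -/
theorem UniformPolytypeStabilityOn.mono {W W' : ℝ → (ℤ → ℤ) → (ℤ → ℝ) → Prop}
    (h : UniformPolytypeStabilityOn W) (hle : ∀ a s z, W' a s z → W a s z) :
    UniformPolytypeStabilityOn W' := by
  unfold UniformPolytypeStabilityOn at *
  obtain ⟨κ, hκ, h⟩ := h
  exact ⟨κ, hκ, fun a s z hW' => h a s z (hle a s z hW')⟩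

/-- The nearest-neighbour strain form is `≥ 0`. [folklore] -/
theorem nnForm_nonneg (a : ℝ) (s : ℤ → ℤ) (z : ℤ → ℝ) (u : E3 → E3) : 0 ≤ nnForm a s z u :=
  tsum_nonneg fun _ => tsum_nonneg fun _ => by split_ifs <;> positivity

/-! ## §2 Uniform heights, the fcc word, and its Bravais lattice -/

/-- Uniform heights `z m = h·m`. [folklore] -/
def zU (h : ℝ) : ℤ → ℝ := fun m => h * m

/-- Uniform increments are `h`. [folklore] -/
theorem zU_succ_sub (h : ℝ) (m : ℤ) : zU h (m + 1) - zU h m = h := by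
  simp only [zU]; push_cast; ring

/-- Uniform heights with `h ∈ [39a/50, 17a/20]` satisfy the height box. [folklore] -/
theorem heightBox_zU {a h : ℝ} (h₁ : 39 / 50 * a ≤ h) (h₂ : h ≤ 17 / 20 * a) :
    HeightBox a (zU h) := fun m => by
  rw [zU_succ_sub]; exact ⟨h₁, h₂⟩

/-- `c • (h e₃) = (c h) e₃`. [folklore] -/
theorem smul_layerNormal (c h : ℝ) : c • layerNormal h = layerNormal (c * h) := by
  ext k; fin_cases k <;> simp [layerNormal]

/-- The fcc Bravais lattice `ℤu_a + ℤv_a + ℤ(w_a + h e₃)` with spacings `a, h` (the tree's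
Barlow period lattice of the constant Hägg word, period `1`). [folklore] -/
def fccLat {a h : ℝ} (ha : a ≠ 0) (hh : h ≠ 0) : Submodule ℤ E3 :=
  barlowPeriodLattice constHagg ha hh one_ne_zero

/-- The fcc lattice is discrete (it is the `ℤ`-span of a basis). [folklore] -/
instance {a h : ℝ} (ha : a ≠ 0) (hh : h ≠ 0) : DiscreteTopology (fccLat ha hh) := by
  unfold fccLat barlowPeriodLattice; infer_instance

/-- The fcc lattice is a full lattice (it is the `ℤ`-span of a basis). [folklore] -/
instance {a h : ℝ} (ha : a ≠ 0) (hh : h ≠ 0) : IsZLattice ℝ (fccLat ha hh) := by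
  unfold fccLat barlowPeriodLattice; infer_instance

/-- `rank fccLat = 3`. [folklore] -/
theorem finrank_fccLat {a h : ℝ} (ha : a ≠ 0) (hh : h ≠ 0) :
    Module.finrank ℤ (fccLat ha hh) = 3 := by
  rw [ZLattice.rank ℝ (fccLat ha hh), finrank_euclideanSpace, Fintype.card_fin]

/-- Membership in the fcc lattice: integer combinations `i u + j v + m w + m h e₃`. [folklore] -/
theorem mem_fccLat_iff {a h : ℝ} (ha : a ≠ 0) (hh : h ≠ 0) (g : E3) :
    g ∈ fccLat ha hh ↔ ∃ m i j : ℤ, g = (i : ℝ) • triangularVec₁ a + (j : ℝ) • triangularVec₂ a +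
      (m : ℝ) • barlowOffset a + (m : ℝ) • layerNormal h := by
  have key : ∀ m : ℤ, (m : ℝ) • ((haggWindow constHagg 0 1 : ℝ) • barlowOffset a +
      ((1 : ℕ) : ℝ) • layerNormal h) = (m : ℝ) • barlowOffset a + (m : ℝ) • layerNormal h := by
    intro m
    rw [haggWindow_const]
    push_cast
    rw [one_smul, one_smul, smul_add]
  constructor
  · intro hg
    obtain ⟨n₀, n₁, n₂, rfl⟩ := exists_eq_of_mem_barlowPeriodLattice constHagg ha hh one_ne_zero hg
    exact ⟨n₂, n₀, n₁, by rw [key]; abel⟩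
  · rintro ⟨m, i, j, rfl⟩
    have := sum_smul_mem_barlowPeriodLattice constHagg ha hh one_ne_zero i j m
    rw [key, ← add_assoc] at this
    exact this

/-- **For the fcc word and uniform heights the site set is the fcc Bravais lattice.** [folklore] -/
theorem sites_const_zU {a h : ℝ} (ha : a ≠ 0) (hh : h ≠ 0) :
    Sites a constHagg (zU h) = (fccLat ha hh : Set E3) := by
  ext g
  rw [SetLike.mem_coe, mem_fccLat_iff]
  simp only [Sites, Set.mem_setOf_eq, haggLabel_const, zU]
  constructor
  · rintro ⟨m, i, j, rfl⟩
    refine ⟨m, i, j, ?_⟩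
    rw [smul_layerNormal, smul_layerNormal, mul_one, mul_comm]
  · rintro ⟨m, i, j, rfl⟩
    refine ⟨m, i, j, ?_⟩
    rw [smul_layerNormal, smul_layerNormal, mul_one, mul_comm]

/-- Lattice vectors are points of the fcc stacking with spacings `a`, `h`. [folklore] -/
theorem mem_fccStacking_of_mem_fccLat {a h : ℝ} (ha : a ≠ 0) (hh : h ≠ 0) {g : E3}
    (hg : g ∈ fccLat ha hh) : g ∈ fccStacking a h := by
  obtain ⟨m, i, j, rfl⟩ := (mem_fccLat_iff ha hh g).1 hg
  exact ⟨m, i, j, by simp [barlowPos]⟩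

/-- Nonzero fcc lattice vectors are long: `‖g‖ ≥ min a h` (`a, h > 0`). [folklore] -/
theorem min_le_norm_of_mem_fccLat {a h : ℝ} (ha : 0 < a) (hh : 0 < h) {g : E3}
    (hg : g ∈ fccLat ha.ne' hh.ne') (hg0 : g ≠ 0) : min a h ≤ ‖g‖ := by
  have h0 : (0 : E3) ∈ fccStacking a h := ⟨0, 0, 0, by simp [barlowPos]⟩
  have := le_dist_of_mem_barlowStacking a h constHagg ha.le hh.le h0
    (mem_fccStacking_of_mem_fccLat ha.ne' hh.ne' hg) hg0.symm
  rwa [dist_eq_norm, zero_sub, norm_neg] at this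

/-! ## §3 Force balance of point-symmetric (Bravais) site sets -/

/-- The force row summand `V′(|p−q|)/|p−q| · (p − q)`. [folklore] -/
def forceTerm (p q : E3) : E3 := (deriv lennardJones (dist p q) / dist p q) • (p - q)

/-- `‖V′(r)/r · (p−q)‖ = |V′(r)| ≤ r⁻¹³ + r⁻⁷`. [folklore] -/
theorem norm_forceTerm_le {p q : E3} (hpq : p ≠ q) :
    ‖forceTerm p q‖ ≤ (dist p q)⁻¹ ^ 13 + (dist p q)⁻¹ ^ 7 := by
  have hd : 0 < dist p q := dist_pos.2 hpq
  rw [forceTerm, norm_smul, ← dist_eq_norm, Real.norm_eq_abs, abs_div, abs_of_pos hd,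
    div_mul_cancel₀ _ hd.ne', deriv_lennardJones hd.ne']
  have hx : 0 ≤ (dist p q)⁻¹ := inv_nonneg.2 hd.le
  refine abs_le.2 ⟨?_, ?_⟩ <;> nlinarith [pow_nonneg hx 13, pow_nonneg hx 7]

/-- The force summand is odd under the point reflection `q ↦ 2p − q`. [folklore] -/
theorem forceTerm_reflect (p q : E3) : forceTerm p ((2 : ℝ) • p - q) = -forceTerm p q := by
  have h1 : dist p ((2 : ℝ) • p - q) = dist p q := by
    rw [dist_eq_norm, dist_eq_norm, two_smul, ← norm_neg (p - q)]
    congr 1; abel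
  have h2 : p - ((2 : ℝ) • p - q) = -(p - q) := by rw [two_smul]; abel
  rw [forceTerm, forceTerm, h1, h2, smul_neg]

/-- In a real vector space `S = −S` forces `S = 0`. [folklore] -/
theorem eq_zero_of_eq_neg_self {S : E3} (h : S = -S) : S = 0 := by
  have h2 : (2 : ℝ) • S = 0 := by
    rw [two_smul]
    nth_rewrite 2 [h]
    exact add_neg_cancel S
  rcases smul_eq_zero.1 h2 with h | h
  · norm_num at h
  · exact h

/-- **Bravais site sets are force balanced.**  If `L(a,s,z)` is, as a set, a discrete `ℤ`-submodule
of rank `3`, then every site is in exact LJ force balance: the force row at `p` is absolutely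
summable (`|V′(r)| ≤ r⁻¹³ + r⁻⁷` over a lattice) and odd under the bijection `q ↦ 2p − q` of the
other sites, hence sums to `0`.  In particular force balance does not constrain `a` or a uniform
spacing `h` at all. [folklore] -/
theorem forceBalanced_of_sites_eq {a : ℝ} {s : ℤ → ℤ} {z : ℤ → ℝ} (L : Submodule ℤ E3)
    [DiscreteTopology L] (hL : Module.finrank ℤ L = 3) (hS : Sites a s z = (L : Set E3)) :
    ForceBalanced a s z := by
  have hSub : ∀ x : E3, x ∈ Sites a s z → x ∈ L := fun x hx => by rw [hS] at hx; exact hx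
  have hSub' : ∀ x : E3, x ∈ L → x ∈ Sites a s z := fun x hx => by rw [hS]; exact hx
  intro p hp
  have hpL : p ∈ L := hSub p hp
  set T := {q : E3 // q ∈ Sites a s z ∧ q ≠ p}
  change HasSum (fun q : T => forceTerm p q.1) 0
  -- absolute summability of the force row
  have hsum : Summable (fun q : T => forceTerm p q.1) := by
    let e : T → L := fun q => ⟨q.1, hSub q.1 q.2.1⟩
    have he : Function.Injective e := by
      intro q q' hqq'
      exact Subtype.ext (congrArg (fun x : L => (x : E3)) hqq')
    have h13 := ZLattice.summable_norm_sub_inv_pow L 13 (by rw [hL]; norm_num) p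
    have h7 := ZLattice.summable_norm_sub_inv_pow L 7 (by rw [hL]; norm_num) p
    have hg : Summable (fun q : T => (dist p q.1)⁻¹ ^ 13 + (dist p q.1)⁻¹ ^ 7) := by
      have := (h13.add h7).comp_injective he
      refine this.congr fun q => ?_
      show ‖(q.1 : E3) - p‖⁻¹ ^ 13 + ‖(q.1 : E3) - p‖⁻¹ ^ 7 = _
      rw [dist_comm, dist_eq_norm]
    exact Summable.of_norm_bounded hg fun q => norm_forceTerm_le (Ne.symm q.2.2)
  -- the point reflection as an involution of the index set
  have hmem : ∀ q : T, (2 : ℝ) • p - q.1 ∈ Sites a s z ∧ (2 : ℝ) • p - q.1 ≠ p := by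
    intro q
    have hq : q.1 ∈ L := hSub q.1 q.2.1
    refine ⟨?_, ?_⟩
    · apply hSub'
      rw [two_smul]
      exact L.sub_mem (L.add_mem hpL hpL) hq
    · intro h
      apply q.2.2
      calc q.1 = (2 : ℝ) • p - ((2 : ℝ) • p - q.1) := by rw [sub_sub_cancel]
        _ = (2 : ℝ) • p - p := by rw [h]
        _ = p := by rw [two_smul, add_sub_cancel_right]
  let σ : T ≃ T :=
    { toFun := fun q => ⟨(2 : ℝ) • p - q.1, hmem q⟩
      invFun := fun q => ⟨(2 : ℝ) • p - q.1, hmem q⟩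
      left_inv := fun q => Subtype.ext (by simp)
      right_inv := fun q => Subtype.ext (by simp) }
  obtain ⟨S, hS'⟩ := hsum
  have h1 : HasSum ((fun q : T => forceTerm p q.1) ∘ σ) S := (Equiv.hasSum_iff σ).2 hS'
  have heq : ((fun q : T => forceTerm p q.1) ∘ σ) = fun q : T => -forceTerm p q.1 := by
    funext q
    exact forceTerm_reflect p q.1
  rw [heq] at h1
  have h2 : HasSum (fun q : T => -forceTerm p q.1) (-S) := hS'.neg
  have hS0 : S = 0 := eq_zero_of_eq_neg_self (h1.unique h2)
  rwa [hS0] at hS'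


/-! ## §4 Single-site displacements on Bravais site sets: the row structure of the second variation -/

/-- The single-site displacement `ξ·𝟙_{0}`. [folklore] -/
def uS (ξ : E3) : E3 → E3 := fun p => if p = 0 then ξ else 0

/-- `u 0 = ξ`. [folklore] -/
@[simp] theorem uS_zero (ξ : E3) : uS ξ 0 = ξ := if_pos rfl

/-- `u p = 0` off the origin. [folklore] -/
theorem uS_of_ne (ξ : E3) {p : E3} (hp : p ≠ 0) : uS ξ p = 0 := if_neg hp

/-- `u` is supported in `{0}`. [folklore] -/
theorem support_uS (ξ : E3) : Function.support (uS ξ) ⊆ {0} := by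
  intro p hp; by_contra h; exact hp (if_neg h)

/-- `u` is finitely supported. [folklore] -/
theorem finite_support_uS (ξ : E3) : (Function.support (uS ξ)).Finite :=
  (Set.finite_singleton (0 : E3)).subset (support_uS ξ)

section Rows

variable {a : ℝ} {s : ℤ → ℤ} {z : ℤ → ℝ}

/-- Sites are lattice vectors (set equality read pointwise, no dependent rewriting). [folklore] -/
theorem mem_of_sites_eq (L : Submodule ℤ E3) (hS : Sites a s z = (L : Set E3)) {x : E3}
    (hx : x ∈ Sites a s z) : x ∈ L := by
  rw [hS] at hx; exact hx

/-- Lattice vectors are sites. [folklore] -/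
theorem mem_sites_of_eq (L : Submodule ℤ E3) (hS : Sites a s z = (L : Set E3)) {x : E3}
    (hx : x ∈ L) : x ∈ Sites a s z := by
  rw [hS]; exact hx

/-- The site with lattice label `x`. [folklore] -/
def ι (L : Submodule ℤ E3) (hS : Sites a s z = (L : Set E3)) (x : L) : Sites a s z :=
  ⟨x, mem_sites_of_eq L hS x.2⟩

/-- Labels determine sites. [folklore] -/
theorem ι_injective (L : Submodule ℤ E3) (hS : Sites a s z = (L : Set E3)) :
    Function.Injective (ι L hS) := fun _ _ h =>
  Subtype.ext (congrArg (fun p : Sites a s z => (p : E3)) h)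

/-- Every site has a label. [folklore] -/
theorem range_ι (L : Submodule ℤ E3) (hS : Sites a s z = (L : Set E3)) :
    Set.range (ι L hS) = Set.univ := by
  refine Set.eq_univ_of_forall fun p => ?_
  exact ⟨⟨p, mem_of_sites_eq L hS p.2⟩, Subtype.ext rfl⟩

/-- Reindexing a site sum by lattice labels. [folklore] -/
theorem tsum_sites_eq (L : Submodule ℤ E3) (hS : Sites a s z = (L : Set E3)) (F : E3 → ℝ) :
    ∑' p : Sites a s z, F p = ∑' x : L, F x := by
  have hr : Function.support (fun p : Sites a s z => F p) ⊆ Set.range (ι L hS) := by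
    rw [range_ι]; exact Set.subset_univ _
  rw [← (ι_injective L hS).tsum_eq hr]
  rfl

/-- Reindexing a double site sum by lattice labels. [folklore] -/
theorem tsum_tsum_sites_eq (L : Submodule ℤ E3) (hS : Sites a s z = (L : Set E3))
    (F : E3 → E3 → ℝ) :
    ∑' p : Sites a s z, ∑' q : Sites a s z, F p q = ∑' x : L, ∑' y : L, F x y := by
  rw [tsum_sites_eq L hS (fun p => ∑' q : Sites a s z, F p q)]
  exact tsum_congr fun x => tsum_sites_eq L hS (F x)

/-- The row function of a single-site displacement: `H(y) = ξᵀK(y)ξ` off the origin. [folklore] -/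
def Hrow (L : Submodule ℤ E3) (ξ : E3) (y : L) : ℝ := if y = 0 then 0 else Hess₀ (y : E3) ξ

/-- On a lattice with no nonzero vector shorter than `1/2` the row function is absolutely summable
(`|ξᵀK(y)ξ| ≤ 904‖y‖⁻⁸`, Mathlib `ZLattice.summable_norm_sub_inv_pow`). [folklore] -/
theorem summable_Hrow (L : Submodule ℤ E3) [DiscreteTopology L] (hL : Module.finrank ℤ L = 3)
    (hmin : ∀ y ∈ L, y ≠ 0 → (1 / 2 : ℝ) ≤ ‖y‖) {ξ : E3} (hξ : ‖ξ‖ = 1) :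
    Summable (Hrow L ξ) := by
  have h8 := ZLattice.summable_norm_sub_inv_pow L 8 (by rw [hL]; norm_num) 0
  simp only [sub_zero] at h8
  refine Summable.of_norm_bounded (h8.mul_left 904) fun y => ?_
  rw [Real.norm_eq_abs]
  unfold Hrow
  split_ifs with hy
  · rw [abs_zero]; positivity
  · have hy' : (y : E3) ≠ 0 := fun h => hy (Submodule.coe_eq_zero.1 h)
    exact abs_Hess₀_le_inv_pow (hmin y y.2 hy') hξ

/-- **Row structure of the second variation of `ξ·𝟙_{0}` on a Bravais site set:** the origin row
is `Σ' H`, the row of a site `x ≠ 0` is the single term `H(x)` (evenness of `K` in both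
arguments), so `hessForm = 2·Σ'_y H(y)`. [folklore] -/
theorem hessForm_single (L : Submodule ℤ E3) [DiscreteTopology L] (hL : Module.finrank ℤ L = 3)
    (hS : Sites a s z = (L : Set E3)) (hmin : ∀ y ∈ L, y ≠ 0 → (1 / 2 : ℝ) ≤ ‖y‖)
    {ξ : E3} (hξ : ‖ξ‖ = 1) :
    hessForm a s z (uS ξ) = 2 * ∑' y : L, Hrow L ξ y := by
  unfold hessForm
  rw [tsum_tsum_sites_eq L hS (fun p q => if p ≠ q then Hess₀ (p - q) (uS ξ p - uS ξ q) else 0)]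
  have hrow : ∀ x : L, (∑' y : L, if (x : E3) ≠ y then Hess₀ ((x : E3) - y) (uS ξ x - uS ξ y) else 0) =
      Hrow L ξ x + if x = 0 then ∑' y, Hrow L ξ y else 0 := by
    intro x
    by_cases hx : x = 0
    · subst hx
      rw [if_pos rfl]
      have h0 : Hrow L ξ 0 = 0 := by simp [Hrow]
      rw [h0, zero_add]
      refine tsum_congr fun y => ?_
      by_cases hy : y = 0
      · subst hy; simp [Hrow]
      · have hy' : (y : E3) ≠ 0 := fun h => hy (Submodule.coe_eq_zero.1 h)
        rw [Submodule.coe_zero, if_pos hy'.symm, uS_zero, uS_of_ne ξ hy', sub_zero, zero_sub,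
          Hess₀_neg_left]
        simp [Hrow, hy]
    · rw [if_neg hx, add_zero]
      have hx' : (x : E3) ≠ 0 := fun h => hx (Submodule.coe_eq_zero.1 h)
      have hfun : (fun y : L => if (x : E3) ≠ y then Hess₀ ((x : E3) - y) (uS ξ x - uS ξ y) else 0) =
          fun y => if y = 0 then Hrow L ξ x else 0 := by
        funext y
        by_cases hy : y = 0
        · subst hy
          rw [if_pos rfl, Submodule.coe_zero, if_pos hx', uS_of_ne ξ hx', uS_zero, sub_zero, zero_sub,
            Hess₀_neg_right]
          simp [Hrow, hx]
        · have hy' : (y : E3) ≠ 0 := fun h => hy (Submodule.coe_eq_zero.1 h)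
          by_cases hxy : (x : E3) = y
          · rw [if_neg (not_not.2 hxy), if_neg hy]
          · rw [if_pos hxy, if_neg hy, uS_of_ne ξ hx', uS_of_ne ξ hy', sub_zero, Hess₀_zero_right]
      rw [hfun, tsum_ite_eq]
  rw [show (fun x : L => ∑' y : L, if (x : E3) ≠ y then Hess₀ ((x : E3) - y) (uS ξ x - uS ξ y) else 0) =
      fun x => Hrow L ξ x + if x = 0 then ∑' y, Hrow L ξ y else 0 from funext hrow]
  rw [(summable_Hrow L hL hmin hξ).tsum_add (hasSum_ite_eq (0 : L) _).summable, tsum_ite_eq]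
  ring

end Rows


/-! ## Part III — the upper bound `a ≤ 1` is load-bearing (dilation witness) -/

section Dilation

/-- `u_a = a·u_1`. [folklore] -/
theorem triangularVec₁_eq_smul (a : ℝ) : triangularVec₁ a = a • triangularVec₁ 1 := by
  ext k; fin_cases k <;> simp [triangularVec₁]

/-- `v_a = a·v_1`. [folklore] -/
theorem triangularVec₂_eq_smul (a : ℝ) : triangularVec₂ a = a • triangularVec₂ 1 := by
  ext k; fin_cases k <;> simp [triangularVec₂] <;> ring

/-- `w_a = a·w_1`. [folklore] -/
theorem barlowOffset_eq_smul (a : ℝ) : barlowOffset a = a • barlowOffset 1 := by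
  ext k; fin_cases k <;> simp [barlowOffset] <;> ring

/-- `(a h) e₃ = a·(h e₃)`. [folklore] -/
theorem layerNormal_mul (a h : ℝ) : layerNormal (a * h) = a • layerNormal h := by
  rw [smul_layerNormal]

/-- `4/5 ≠ 0`. [folklore] -/
theorem four_fifths_ne : (4 / 5 : ℝ) ≠ 0 := by norm_num

/-- The unit witness lattice `L₁ = ℤu + ℤv + ℤ(w + (4/5)e₃)` (fcc word, `a = 1`, `h = 4/5`). [folklore] -/
def L₁ : Submodule ℤ E3 := fccLat one_ne_zero four_fifths_ne

/-- `L₁` is discrete. [folklore] -/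
instance : DiscreteTopology L₁ := by unfold L₁; infer_instance

/-- `rank L₁ = 3`. [folklore] -/
theorem finrank_L₁ : Module.finrank ℤ L₁ = 3 := finrank_fccLat _ _

/-- `4a/5 ≠ 0` for `a ≠ 0`. [folklore] -/
theorem ha45 {a : ℝ} (ha : a ≠ 0) : 4 * a / 5 ≠ 0 := by
  intro h; apply ha; linarith

/-- The dilated witness lattice `L_a = ℤu_a + ℤv_a + ℤ(w_a + (4a/5)e₃)`. [folklore] -/
def La {a : ℝ} (ha : a ≠ 0) : Submodule ℤ E3 := fccLat ha (ha45 ha)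

/-- `L_a` is discrete. [folklore] -/
instance {a : ℝ} (ha : a ≠ 0) : DiscreteTopology (La ha) := by unfold La; infer_instance

/-- `L_a = a · L₁` pointwise. [folklore] -/
theorem mem_La_iff {a : ℝ} (ha : a ≠ 0) (g : E3) : g ∈ La ha ↔ ∃ x ∈ L₁, g = a • x := by
  unfold La L₁
  rw [mem_fccLat_iff]
  constructor
  · rintro ⟨m, i, j, rfl⟩
    refine ⟨(i : ℝ) • triangularVec₁ 1 + (j : ℝ) • triangularVec₂ 1 + (m : ℝ) • barlowOffset 1 +
      (m : ℝ) • layerNormal (4 / 5), (mem_fccLat_iff _ _ _).2 ⟨m, i, j, rfl⟩, ?_⟩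
    rw [triangularVec₁_eq_smul a, triangularVec₂_eq_smul a, barlowOffset_eq_smul a,
      show (4 * a / 5 : ℝ) = a * (4 / 5) by ring, layerNormal_mul]
    simp only [smul_add, smul_comm (_ : ℝ) a]
  · rintro ⟨x, hx, rfl⟩
    obtain ⟨m, i, j, rfl⟩ := (mem_fccLat_iff _ _ _).1 hx
    refine ⟨m, i, j, ?_⟩
    rw [triangularVec₁_eq_smul a, triangularVec₂_eq_smul a, barlowOffset_eq_smul a,
      show (4 * a / 5 : ℝ) = a * (4 / 5) by ring, layerNormal_mul]
    simp only [smul_add, smul_comm (_ : ℝ) a]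

/-- The scaling bijection `L₁ ≃ L_a`, `x ↦ a·x`. [folklore] -/
def scaleEquiv {a : ℝ} (ha : a ≠ 0) : L₁ ≃ La ha where
  toFun x := ⟨a • (x : E3), (mem_La_iff ha _).2 ⟨x, x.2, rfl⟩⟩
  invFun y := ⟨a⁻¹ • (y : E3), by
    obtain ⟨x, hx, hy⟩ := (mem_La_iff ha (y : E3)).1 y.2
    rw [hy, smul_smul, inv_mul_cancel₀ ha, one_smul]; exact hx⟩
  left_inv x := Subtype.ext (by simp [smul_smul, inv_mul_cancel₀ ha])
  right_inv y := Subtype.ext (by simp [smul_smul, mul_inv_cancel₀ ha])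

/-- `scaleEquiv x = a·x` as vectors. [folklore] -/
@[simp] theorem coe_scaleEquiv {a : ℝ} (ha : a ≠ 0) (x : L₁) :
    ((scaleEquiv ha x : La ha) : E3) = a • (x : E3) := rfl

/-- Nonzero vectors of `L₁` have norm `≥ 4/5`. [folklore] -/
theorem norm_ge_of_mem_L₁ {x : E3} (hx : x ∈ L₁) (hx0 : x ≠ 0) : (4 / 5 : ℝ) ≤ ‖x‖ := by
  have := min_le_norm_of_mem_fccLat (a := 1) (h := 4 / 5) one_pos (by norm_num) hx hx0
  refine le_trans ?_ this
  rw [min_eq_right (by norm_num)]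

/-- Nonzero vectors of `L_a` have norm `≥ 4a/5 ≥ 1/2` once `a ≥ 1`. [folklore] -/
theorem norm_ge_of_mem_La {a : ℝ} (ha1 : 1 ≤ a) {y : E3} (hy : y ∈ La (by positivity : a ≠ 0))
    (hy0 : y ≠ 0) : (1 / 2 : ℝ) ≤ ‖y‖ := by
  have ha : 0 < a := by positivity
  have := min_le_norm_of_mem_fccLat (a := a) (h := 4 * a / 5) ha (by positivity) hy hy0
  refine le_trans ?_ this
  rw [min_eq_right (by linarith)]
  linarith

/-! ### The scaling law of the force-constant form -/

/-- `ξᵀK(a x)ξ = a⁻⁸·|x|⁻⁸(1 − 8c²) + a⁻¹⁴·|x|⁻¹⁴(14c² − 1)`, `c = ⟪x,ξ⟫/|x|`, for `x ≠ 0`,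
`a > 0`, `‖ξ‖ = 1` (from `V′(r) = −r⁻¹³ + r⁻⁷`, `V″(r) = 13r⁻¹⁴ − 7r⁻⁸`). [folklore] -/
theorem Hess₀_smul {a : ℝ} (ha : 0 < a) {x : E3} (hx : x ≠ 0) {ξ : E3} (hξ : ‖ξ‖ = 1) :
    Hess₀ (a • x) ξ =
      (a⁻¹) ^ 8 * ((‖x‖⁻¹) ^ 8 * (1 - 8 * (inner ℝ x ξ / ‖x‖) ^ 2)) +
        (a⁻¹) ^ 14 * ((‖x‖⁻¹) ^ 14 * (14 * (inner ℝ x ξ / ‖x‖) ^ 2 - 1)) := by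
  have hxn : 0 < ‖x‖ := norm_pos_iff.2 hx
  have han : ‖a • x‖ = a * ‖x‖ := by rw [norm_smul, Real.norm_eq_abs, abs_of_pos ha]
  have hne : a * ‖x‖ ≠ 0 := by positivity
  have hc : inner ℝ (a • x) ξ / ‖a • x‖ = inner ℝ x ξ / ‖x‖ := by
    rw [han, real_inner_smul_left, mul_div_mul_left _ _ ha.ne']
  unfold Hess₀
  rw [hc, han, deriv_deriv_lennardJones hne, deriv_lennardJones hne, hξ, mul_inv]
  ring

/-- The `r⁻⁸` coefficient row: `G₈(x) = |x|⁻⁸(1 − 8c²)` off the origin. [folklore] -/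
def G₈ (ξ : E3) (x : L₁) : ℝ :=
  if x = 0 then 0 else (‖(x : E3)‖⁻¹) ^ 8 * (1 - 8 * (inner ℝ (x : E3) ξ / ‖(x : E3)‖) ^ 2)

/-- The `r⁻¹⁴` coefficient row: `G₁₄(x) = |x|⁻¹⁴(14c² − 1)` off the origin. [folklore] -/
def G₁₄ (ξ : E3) (x : L₁) : ℝ :=
  if x = 0 then 0 else (‖(x : E3)‖⁻¹) ^ 14 * (14 * (inner ℝ (x : E3) ξ / ‖(x : E3)‖) ^ 2 - 1)

/-- `c² ≤ 1` for the direction cosine `c = ⟪x,ξ⟫/|x|`, `‖ξ‖ = 1`. [folklore] -/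
theorem cos_sq_le_one (x : E3) {ξ : E3} (hξ : ‖ξ‖ = 1) : (inner ℝ x ξ / ‖x‖) ^ 2 ≤ 1 := by
  rcases eq_or_ne x 0 with rfl | hx
  · simp
  · have hpos : 0 < ‖x‖ := norm_pos_iff.2 hx
    have hcs : |inner ℝ x ξ| ≤ ‖x‖ * ‖ξ‖ := abs_real_inner_le_norm x ξ
    rw [hξ, mul_one] at hcs
    have : |inner ℝ x ξ / ‖x‖| ≤ 1 := by
      rw [abs_div, abs_of_pos hpos, div_le_one hpos]; exact hcs
    have h2 : (inner ℝ x ξ / ‖x‖) ^ 2 = |inner ℝ x ξ / ‖x‖| ^ 2 := (sq_abs _).symm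
    rw [h2]
    nlinarith [abs_nonneg (inner ℝ x ξ / ‖x‖)]

/-- `|G₈| ≤ 7|x|⁻⁸`. [folklore] -/
theorem abs_G₈_le {ξ : E3} (hξ : ‖ξ‖ = 1) (x : L₁) : |G₈ ξ x| ≤ 7 * (‖(x : E3)‖⁻¹) ^ 8 := by
  unfold G₈
  split_ifs with hx
  · rw [abs_zero]; positivity
  · rw [abs_mul, abs_of_nonneg (by positivity : (0 : ℝ) ≤ (‖(x : E3)‖⁻¹) ^ 8), mul_comm]
    refine mul_le_mul_of_nonneg_right ?_ (by positivity)
    have h1 := cos_sq_le_one (x : E3) hξ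
    have h0 : 0 ≤ (inner ℝ (x : E3) ξ / ‖(x : E3)‖) ^ 2 := sq_nonneg _
    exact abs_le.2 ⟨by linarith, by linarith⟩

/-- `|G₁₄| ≤ 13|x|⁻¹⁴`. [folklore] -/
theorem abs_G₁₄_le {ξ : E3} (hξ : ‖ξ‖ = 1) (x : L₁) : |G₁₄ ξ x| ≤ 13 * (‖(x : E3)‖⁻¹) ^ 14 := by
  unfold G₁₄
  split_ifs with hx
  · rw [abs_zero]; positivity
  · rw [abs_mul, abs_of_nonneg (by positivity : (0 : ℝ) ≤ (‖(x : E3)‖⁻¹) ^ 14), mul_comm]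
    refine mul_le_mul_of_nonneg_right ?_ (by positivity)
    have h1 := cos_sq_le_one (x : E3) hξ
    have h0 : 0 ≤ (inner ℝ (x : E3) ξ / ‖(x : E3)‖) ^ 2 := sq_nonneg _
    exact abs_le.2 ⟨by linarith, by linarith⟩

/-- Lattice sums of `|x|⁻ⁿ` over `L₁` converge for `n > 3`. [folklore] -/
theorem summable_inv_pow_L₁ {n : ℕ} (hn : 3 < n) : Summable fun x : L₁ => (‖(x : E3)‖⁻¹) ^ n := by
  have := ZLattice.summable_norm_sub_inv_pow L₁ n (by rw [finrank_L₁]; exact hn) 0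
  simpa only [sub_zero] using this

/-- `G₈` is summable. [folklore] -/
theorem summable_G₈ {ξ : E3} (hξ : ‖ξ‖ = 1) : Summable (G₈ ξ) :=
  Summable.of_norm_bounded ((summable_inv_pow_L₁ (by norm_num : 3 < 8)).mul_left 7) fun x => by
    rw [Real.norm_eq_abs]; exact abs_G₈_le hξ x

/-- `G₁₄` is summable. [folklore] -/
theorem summable_G₁₄ {ξ : E3} (hξ : ‖ξ‖ = 1) : Summable (G₁₄ ξ) :=
  Summable.of_norm_bounded ((summable_inv_pow_L₁ (by norm_num : 3 < 14)).mul_left 13) fun x => by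
    rw [Real.norm_eq_abs]; exact abs_G₁₄_le hξ x

/-- The two lattice constants `S₈(ξ) = Σ' G₈`, `S₁₄(ξ) = Σ' G₁₄`. [folklore] -/
def S₈ (ξ : E3) : ℝ := ∑' x : L₁, G₈ ξ x

/-- `S₁₄(ξ) = Σ' G₁₄`. [folklore] -/
def S₁₄ (ξ : E3) : ℝ := ∑' x : L₁, G₁₄ ξ x

/-- **The dilated row sum scales:** `Σ'_{y ∈ L_a} H(y) = a⁻⁸ S₈(ξ) + a⁻¹⁴ S₁₄(ξ)`. [folklore] -/
theorem tsum_Hrow_La {a : ℝ} (ha1 : 1 ≤ a) {ξ : E3} (hξ : ‖ξ‖ = 1) :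
    ∑' y : La (by positivity : a ≠ 0), Hrow (La (by positivity : a ≠ 0)) ξ y =
      (a⁻¹) ^ 8 * S₈ ξ + (a⁻¹) ^ 14 * S₁₄ ξ := by
  have ha : 0 < a := by positivity
  have ha' : a ≠ 0 := ha.ne'
  rw [← Equiv.tsum_eq (scaleEquiv ha')]
  have hterm : ∀ x : L₁, Hrow (La ha') ξ (scaleEquiv ha' x) =
      (a⁻¹) ^ 8 * G₈ ξ x + (a⁻¹) ^ 14 * G₁₄ ξ x := by
    intro x
    unfold Hrow G₈ G₁₄
    by_cases hx : x = 0
    · subst hx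
      have : scaleEquiv ha' (0 : L₁) = 0 := Subtype.ext (by simp)
      rw [this, if_pos rfl, if_pos rfl, if_pos rfl]; ring
    · have hx' : (x : E3) ≠ 0 := fun h => hx (Submodule.coe_eq_zero.1 h)
      have hsx : scaleEquiv ha' x ≠ 0 := by
        intro h
        have : ((scaleEquiv ha' x : La ha') : E3) = 0 := by rw [h]; rfl
        rw [coe_scaleEquiv] at this
        exact hx' ((smul_eq_zero.1 this).resolve_left ha')
      rw [if_neg hsx, if_neg hx, if_neg hx, coe_scaleEquiv, Hess₀_smul ha hx' hξ]
  rw [tsum_congr hterm, ((summable_G₈ hξ).mul_left _).tsum_add ((summable_G₁₄ hξ).mul_left _),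
    tsum_mul_left, tsum_mul_left]
  rfl

/-! ### Pigeonhole over the three axes: some `S₈(eᵢ) < 0` -/

/-- The coordinate unit vector `eᵢ`. [folklore] -/
def eAx (i : Fin 3) : E3 := EuclideanSpace.single i (1 : ℝ)

/-- `‖eᵢ‖ = 1`. [folklore] -/
theorem norm_eAx (i : Fin 3) : ‖eAx i‖ = 1 := by
  rw [eAx, PiLp.norm_single, norm_one]

/-- `⟪x, eᵢ⟫ = xᵢ`. [folklore] -/
theorem inner_eAx (x : E3) (i : Fin 3) : inner ℝ x (eAx i) = x i := by
  rw [eAx, EuclideanSpace.inner_single_right]; simp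

/-- `Σᵢ cᵢ² = 1` for the direction cosines of `x ≠ 0`. [folklore] -/
theorem sum_cos_sq {x : E3} (hx : x ≠ 0) : ∑ i : Fin 3, (inner ℝ x (eAx i) / ‖x‖) ^ 2 = 1 := by
  have hpos : 0 < ‖x‖ := norm_pos_iff.2 hx
  simp only [inner_eAx, div_pow]
  rw [← Finset.sum_div, div_eq_one_iff_eq (by positivity)]
  rw [EuclideanSpace.norm_sq_eq]
  exact Finset.sum_congr rfl fun i _ => by rw [Real.norm_eq_abs, sq_abs]

/-- The bare lattice sum row `Z(x) = |x|⁻⁸` off the origin. [folklore] -/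
def Z₈ (x : L₁) : ℝ := if x = 0 then 0 else (‖(x : E3)‖⁻¹) ^ 8

/-- `Σᵢ G₈(eᵢ)(x) = −5·Z(x)`. [folklore] -/
theorem sum_G₈_eAx (x : L₁) : ∑ i : Fin 3, G₈ (eAx i) x = -5 * Z₈ x := by
  unfold G₈ Z₈
  by_cases hx : x = 0
  · simp [hx]
  · have hx' : (x : E3) ≠ 0 := fun h => hx (Submodule.coe_eq_zero.1 h)
    simp only [if_neg hx]
    rw [← Finset.mul_sum, Finset.sum_sub_distrib, ← Finset.mul_sum, sum_cos_sq hx']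
    simp
    ring

/-- `Z` is summable. [folklore] -/
theorem summable_Z₈ : Summable Z₈ := by
  refine Summable.of_norm_bounded (summable_inv_pow_L₁ (by norm_num : 3 < 8)) fun x => ?_
  unfold Z₈
  split_ifs <;> simp

/-- `u = (1,0,0) ∈ L₁`. [folklore] -/
theorem triangularVec₁_mem_L₁ : triangularVec₁ 1 ∈ L₁ :=
  (mem_fccLat_iff _ _ _).2 ⟨0, 1, 0, by simp⟩

/-- `‖u‖ = 1`. [folklore] -/
theorem norm_triangularVec₁_one : ‖triangularVec₁ (1 : ℝ)‖ = 1 := by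
  rw [EuclideanSpace.norm_eq]
  simp [triangularVec₁, Fin.sum_univ_three]

/-- The bare lattice sum is positive: `Σ' Z ≥ Z(u) = 1`. [folklore] -/
theorem tsum_Z₈_pos : 0 < ∑' x, Z₈ x := by
  set u₀ : L₁ := ⟨triangularVec₁ 1, triangularVec₁_mem_L₁⟩
  have hu : Z₈ u₀ = 1 := by
    have hne : u₀ ≠ 0 := by
      intro h
      have : ((u₀ : L₁) : E3) = 0 := by rw [h]; rfl
      have hn := norm_triangularVec₁_one
      rw [show triangularVec₁ (1 : ℝ) = (u₀ : E3) from rfl, this, norm_zero] at hn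
      norm_num at hn
    unfold Z₈
    rw [if_neg hne, show ((u₀ : L₁) : E3) = triangularVec₁ 1 from rfl, norm_triangularVec₁_one]
    norm_num
  have hle : Z₈ u₀ ≤ ∑' x, Z₈ x :=
    summable_Z₈.le_tsum u₀ fun x _ => by unfold Z₈; split_ifs <;> positivity
  linarith

/-- **Pigeonhole:** `Σᵢ S₈(eᵢ) = −5·Σ'Z < 0`, hence `S₈(eᵢ) < 0` for some axis `i`. [folklore] -/
theorem exists_S₈_neg : ∃ i : Fin 3, S₈ (eAx i) < 0 := by
  have hsum : ∑ i : Fin 3, S₈ (eAx i) = -5 * ∑' x, Z₈ x := by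
    unfold S₈
    rw [← Summable.tsum_finsetSum (fun i _ => summable_G₈ (norm_eAx i))]
    rw [tsum_congr sum_G₈_eAx, tsum_mul_left]
  by_contra h
  push Not at h
  have : 0 ≤ ∑ i : Fin 3, S₈ (eAx i) := Finset.sum_nonneg fun i _ => h i
  linarith [tsum_Z₈_pos]

/-! ### The refutation -/

/-- **The upper bound `a ≤ 1` on the in-layer spacing is load-bearing.**  On the window
`47/50 ≤ a ∧ IsHaggSeq s ∧ HeightBox a z` (the crux's `Box` without `a ≤ 1`) uniform polytype
stability FAILS: the dilated fcc lattice `L_a` (word `constHagg`, uniform heights `4a/5·m`, in the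
height box and force balanced for every `a`) carries the single-site displacement `eᵢ·𝟙_{0}` whose
second variation is `2(a⁻⁸S₈(eᵢ) + a⁻¹⁴S₁₄(eᵢ))` with `Σᵢ S₈(eᵢ) = −5Σ'_{x≠0}|x|⁻⁸ < 0`; for the
axis with `S₈ < 0` and `a = max 1 (|S₁₄|/(−S₈) + 1)` it is negative, while `κ·N(u) ≥ 0`.
Physically: a uniformly dilated LJ crystal sits on the concave `r⁻⁶` tail and is harmonically
unstable; numerically the instability already starts at `a ≈ 1.06` (`h = √(2/3)a`) resp.
`a ≈ 1.055` (`h = 0.85a`), i.e. within `6 %` of the crux's edge `a = 1` (disprover's Bloch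
scan, Disproof.lean Part V). [folklore] -/
theorem uniformPolytypeStability_false_without_upperA :
    ¬ UniformPolytypeStabilityOn fun a s z => 47 / 50 ≤ a ∧ IsHaggSeq s ∧ HeightBox a z := by
  rintro ⟨κ, hκ, h⟩
  obtain ⟨i, hi⟩ := exists_S₈_neg
  set ξ : E3 := eAx i
  have hξ : ‖ξ‖ = 1 := norm_eAx i
  set B : ℝ := |S₁₄ ξ|
  set a : ℝ := max 1 (B / (-S₈ ξ) + 1) with ha_def
  have ha1 : 1 ≤ a := le_max_left _ _
  have ha : 0 < a := by positivity
  have ha' : a ≠ 0 := ha.ne'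
  have hneg : 0 < -S₈ ξ := by linarith
  -- the witness data
  have hS : Sites a constHagg (zU (4 * a / 5)) = (La ha' : Set E3) := sites_const_zU ha' (ha45 ha')
  have hW : 47 / 50 ≤ a ∧ IsHaggSeq constHagg ∧ HeightBox a (zU (4 * a / 5)) :=
    ⟨by linarith, isHaggSeq_const, heightBox_zU (by linarith) (by linarith)⟩
  have hF : ForceBalanced a constHagg (zU (4 * a / 5)) :=
    forceBalanced_of_sites_eq (La ha') (finrank_fccLat _ _) hS
  have hsupp : Function.support (uS ξ) ⊆ Sites a constHagg (zU (4 * a / 5)) :=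
    (support_uS ξ).trans (by
      intro p hp
      rw [Set.mem_singleton_iff] at hp
      subst hp
      rw [hS]
      exact (La ha').zero_mem)
  have key := h a constHagg (zU (4 * a / 5)) hW hF (uS ξ) (finite_support_uS ξ) hsupp
  -- the second variation of the witness
  have hmin : ∀ y ∈ La ha', y ≠ 0 → (1 / 2 : ℝ) ≤ ‖y‖ := fun y hy hy0 => norm_ge_of_mem_La ha1 hy hy0
  rw [hessForm_single (La ha') (finrank_fccLat _ _) hS hmin hξ, tsum_Hrow_La ha1 hξ] at key
  -- sign of a⁻⁸ S₈ + a⁻¹⁴ S₁₄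
  have hainv : 0 < a⁻¹ := inv_pos.2 ha
  have hainv1 : a⁻¹ ≤ 1 := inv_le_one_of_one_le₀ ha1
  have hgt : B < a * (-S₈ ξ) := by
    have h1 : B / (-S₈ ξ) + 1 ≤ a := le_max_right _ _
    have h2 : B / (-S₈ ξ) < a := by linarith
    exact (div_lt_iff₀ hneg).1 h2
  have h6 : (a⁻¹) ^ 6 ≤ a⁻¹ := pow_le_of_le_one hainv.le hainv1 (by norm_num)
  have hS14 : S₁₄ ξ ≤ B := le_abs_self _
  have hB : 0 ≤ B := abs_nonneg _
  -- a⁻¹⁴ S₁₄ ≤ a⁻¹⁴ B ≤ a⁻⁸ · a⁻¹ · B < a⁻⁸ · (−S₈)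
  have hstep : (a⁻¹) ^ 14 * S₁₄ ξ < (a⁻¹) ^ 8 * (-S₈ ξ) := by
    have e14 : (a⁻¹) ^ 14 = (a⁻¹) ^ 8 * (a⁻¹) ^ 6 := by ring
    have h8pos : 0 < (a⁻¹) ^ 8 := by positivity
    have hlt : a⁻¹ * B < -S₈ ξ := by
      rw [inv_mul_lt_iff₀ ha]; exact hgt
    calc (a⁻¹) ^ 14 * S₁₄ ξ ≤ (a⁻¹) ^ 14 * B := by gcongr
      _ = (a⁻¹) ^ 8 * ((a⁻¹) ^ 6 * B) := by rw [e14]; ring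
      _ ≤ (a⁻¹) ^ 8 * (a⁻¹ * B) := by gcongr
      _ < (a⁻¹) ^ 8 * (-S₈ ξ) := by gcongr
  have hnn := nnForm_nonneg a constHagg (zU (4 * a / 5)) (uS ξ)
  have hκnn : 0 ≤ κ * nnForm a constHagg (zU (4 * a / 5)) (uS ξ) := mul_nonneg hκ.le hnn
  nlinarith

end Dilation

/-! ## Part III′ — the UPPER height bound `z(m+1) − z(m) ≤ 17a/20` is load-bearing (membrane buckling; PROVED)

Ingredients: the planar estimate `tsum_ψpl_lt : Σ'_{η ∈ Λ∖0} V′(|η|)/|η| < −3/2` at `a₀ = 47/50`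
(`Theorems/UniformPolytypeStability/Negative/Membrane.lean`, p170285 ACCEPTED, imported: six NN at
`r = 0.94` give `6·(−0.7375) = −4.425` EXACTLY, the rest is `≥ 0` termwise and `≤ 2.597` by a
`5 × 5`-block + two-strip majorant `r⁻⁸ ≤ (256/81)·i⁻⁴φ(j)` summed with `hasSum_zeta_four` and
`π < 3.15`; true tail `0.164`, true sum `−4.261`, j026943/B2); parts I–II; Tannery
(`tendsto_tsum_of_dominated_convergence`) over the fcc lattice at `H = 1` with the landed
`|ξᵀK(y)ξ| ≤ 904‖y‖⁻⁸`.  This section is byte-identical (up to the namespace) to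
`Negative/HeightUpper.lean` (ready; proposable once `Rows` is in the tree). -/

section HeightUpper

open Summit.AtomisticToContinuum.Crystallization.Theorems.UniformPolytypeStabilityNegative


/-- The vertical unit vector `e₃`. [folklore] -/
def e₃ : E3 := EuclideanSpace.single 2 (1 : ℝ)

/-- `‖e₃‖ = 1`. [folklore] -/
theorem norm_e₃ : ‖e₃‖ = 1 := by
  rw [e₃, PiLp.norm_single, norm_one]

/-- `⟪x, e₃⟫ = x₃`. [folklore] -/
theorem inner_e₃ (x : E3) : inner ℝ x e₃ = x 2 := by
  rw [e₃, EuclideanSpace.inner_single_right]; simp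

/-- `a₀ ≠ 0`. [folklore] -/
theorem a₀_ne_zero : a₀ ≠ 0 := by unfold a₀; norm_num

/-- The labelled vector `Y_H(i,j,m) = i u + j v + m w + m H e₃` of the fcc lattice with in-layer
spacing `a₀` and uniform layer spacing `H`. [folklore] -/
def Y (H : ℝ) (n : ℤ × ℤ × ℤ) : E3 := barlowPos a₀ H constHagg n.2.2 n.1 n.2.1

/-- First coordinate of `Y`. [folklore] -/
theorem Y_apply_zero (H : ℝ) (n : ℤ × ℤ × ℤ) :
    Y H n 0 = a₀ * (n.1 + n.2.1 / 2 + n.2.2 / 2) := by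
  simp [Y]

/-- Second coordinate of `Y`. [folklore] -/
theorem Y_apply_one (H : ℝ) (n : ℤ × ℤ × ℤ) :
    Y H n 1 = a₀ * √3 / 2 * (n.2.1 + n.2.2 / 3) := by
  simp [Y]

/-- Third coordinate of `Y`. [folklore] -/
theorem Y_apply_two (H : ℝ) (n : ℤ × ℤ × ℤ) : Y H n 2 = n.2.2 * H := by
  simp [Y]

/-- `Y_H(0) = 0`. [folklore] -/
theorem Y_zero (H : ℝ) : Y H 0 = 0 := by
  simp [Y, barlowPos]

/-- `Y_H(n)` is a vector of the fcc lattice `fccLat a₀ H`. [folklore] -/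
theorem Y_mem {H : ℝ} (hH : H ≠ 0) (n : ℤ × ℤ × ℤ) : Y H n ∈ fccLat a₀_ne_zero hH :=
  (mem_fccLat_iff a₀_ne_zero hH _).2 ⟨n.2.2, n.1, n.2.1, by simp only [Y, barlowPos, haggLabel_const]⟩

/-- Every fcc lattice vector is labelled. [folklore] -/
theorem exists_Y_eq {H : ℝ} (hH : H ≠ 0) {g : E3} (hg : g ∈ fccLat a₀_ne_zero hH) :
    ∃ n, Y H n = g := by
  obtain ⟨m, i, j, rfl⟩ := (mem_fccLat_iff a₀_ne_zero hH g).1 hg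
  exact ⟨(i, j, m), by simp only [Y, barlowPos, haggLabel_const]⟩

/-- Labels are unique. [folklore] -/
theorem Y_injective {H : ℝ} (hH : H ≠ 0) : Function.Injective (Y H) := by
  rintro ⟨i, j, m⟩ ⟨i', j', m'⟩ h
  have h2 := congrArg (fun x : E3 => x 2) h
  have h1 := congrArg (fun x : E3 => x 1) h
  have h0 := congrArg (fun x : E3 => x 0) h
  simp only [Y_apply_two, Y_apply_one, Y_apply_zero] at h0 h1 h2
  have ha : (0 : ℝ) < a₀ := by unfold a₀; norm_num
  have h3 : (0 : ℝ) < √3 := Real.sqrt_pos.2 (by norm_num)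
  have hm : (m : ℝ) = m' := mul_right_cancel₀ hH h2
  have hj : (j : ℝ) = j' := by
    have := mul_left_cancel₀ (show a₀ * √3 / 2 ≠ 0 by positivity) h1
    linarith
  have hi : (i : ℝ) = i' := by
    have := mul_left_cancel₀ ha.ne' h0
    linarith
  have hm' : m = m' := by exact_mod_cast hm
  have hj' : j = j' := by exact_mod_cast hj
  have hi' : i = i' := by exact_mod_cast hi
  rw [hm', hj', hi']

/-- `‖Y_H(i,j,m)‖² = a₀²(i + j/2 + m/2)² + (3a₀²/4)(j + m/3)² + m²H²`. [folklore] -/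
theorem norm_sq_Y (H : ℝ) (n : ℤ × ℤ × ℤ) :
    ‖Y H n‖ ^ 2 = (a₀ * (n.1 + n.2.1 / 2 + n.2.2 / 2)) ^ 2 +
      (a₀ * √3 / 2 * (n.2.1 + n.2.2 / 3)) ^ 2 + (n.2.2 * H) ^ 2 := by
  rw [EuclideanSpace.norm_sq_eq, Fin.sum_univ_three, Y_apply_zero, Y_apply_one, Y_apply_two]
  simp only [Real.norm_eq_abs, sq_abs]

/-- In-plane vectors do not see `H`. [folklore] -/
theorem Y_planar (H : ℝ) (i j : ℤ) : Y H (i, j, 0) = Y 1 (i, j, 0) := by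
  ext k
  fin_cases k <;> simp [Y]

/-- `‖i u + j v‖² = a₀²(i² + ij + j²)`. [folklore] -/
theorem norm_sq_Y_planar (H : ℝ) (i j : ℤ) : ‖Y H (i, j, 0)‖ ^ 2 = a₀ ^ 2 * (Qf (i, j) : ℝ) := by
  have h3 : (√3 : ℝ) ^ 2 = 3 := Real.sq_sqrt (by norm_num)
  rw [norm_sq_Y]
  simp only [Qf]
  push_cast
  linear_combination (a₀ ^ 2 * (j : ℝ) ^ 2 / 4) * h3

/-- The norm of a labelled vector is monotone in `H ≥ 1`. [folklore] -/
theorem norm_Y_one_le {H : ℝ} (hH : 1 ≤ H) (n : ℤ × ℤ × ℤ) : ‖Y 1 n‖ ≤ ‖Y H n‖ := by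
  have hH2 : (1 : ℝ) ≤ H ^ 2 := by nlinarith
  have hsq : ‖Y 1 n‖ ^ 2 ≤ ‖Y H n‖ ^ 2 := by
    rw [norm_sq_Y, norm_sq_Y]
    nlinarith [mul_nonneg (sq_nonneg (n.2.2 : ℝ)) (sub_nonneg.2 hH2)]
  exact le_of_pow_le_pow_left₀ two_ne_zero (norm_nonneg _) hsq

/-- Vectors off the basal layer are at least `H` long. [folklore] -/
theorem le_norm_Y (H : ℝ) {n : ℤ × ℤ × ℤ} (hm : n.2.2 ≠ 0) : H ≤ ‖Y H n‖ := by
  have hm1 : (1 : ℝ) ≤ (n.2.2 : ℝ) ^ 2 := by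
    have h : (1 : ℤ) ≤ n.2.2 ^ 2 := by nlinarith [Int.one_le_abs hm, sq_abs n.2.2]
    exact_mod_cast h
  have hsq : H ^ 2 ≤ ‖Y H n‖ ^ 2 := by
    rw [norm_sq_Y]
    nlinarith [sq_nonneg (a₀ * (n.1 + n.2.1 / 2 + n.2.2 / 2)),
      sq_nonneg (a₀ * √3 / 2 * (n.2.1 + n.2.2 / 3)), mul_nonneg (sub_nonneg.2 hm1) (sq_nonneg H)]
  exact le_of_pow_le_pow_left₀ two_ne_zero (norm_nonneg _) hsq

/-- For `H ≥ 1` nonzero vectors are at least `1/2` long (`‖g‖ ≥ min a₀ H = a₀`). [folklore] -/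
theorem half_le_norm_Y {H : ℝ} (hH : 1 ≤ H) {n : ℤ × ℤ × ℤ} (hn : Y H n ≠ 0) :
    (1 / 2 : ℝ) ≤ ‖Y H n‖ := by
  have hH0 : (0 : ℝ) < H := by linarith
  have ha : (0 : ℝ) < a₀ := by unfold a₀; norm_num
  have h := min_le_norm_of_mem_fccLat ha hH0 (Y_mem hH0.ne' n) hn
  have : (1 / 2 : ℝ) ≤ min a₀ H := le_min (by unfold a₀; norm_num) (by linarith)
  linarith

/-- The row weight `hr(x) = e₃ᵀK(x)e₃` of the vertical single-site displacement (`0` at the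
origin). [folklore] -/
def hr (x : E3) : ℝ := if x = 0 then 0 else Hess₀ x e₃

/-- `hr 0 = 0`. [folklore] -/
theorem hr_zero : hr 0 = 0 := if_pos rfl

/-- `|hr(x)| ≤ 904‖x‖⁻⁸` (at `x = 0` or `‖x‖ ≥ 1/2`). [folklore] -/
theorem abs_hr_le {x : E3} (hx : x = 0 ∨ (1 / 2 : ℝ) ≤ ‖x‖) : |hr x| ≤ 904 * (‖x‖⁻¹) ^ 8 := by
  unfold hr
  rcases eq_or_ne x 0 with rfl | hne
  · simp
  · rw [if_neg hne]
    exact abs_Hess₀_le_inv_pow (hx.resolve_left hne) norm_e₃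

/-- On the basal layer the row weight is the planar transverse weight of part IV-a:
`hr(i u + j v) = V′(r)/r = ψ(i² + ij + j²)`. [folklore] -/
theorem hr_Y_planar (i j : ℤ) : hr (Y 1 (i, j, 0)) = ψpl (i, j) := by
  unfold hr ψpl
  by_cases h0 : ((i, j) : ℤ × ℤ) = 0
  · have hi : i = 0 := congrArg Prod.fst h0
    have hj : j = 0 := congrArg Prod.snd h0
    subst hi hj
    have hY : Y 1 ((0 : ℤ), (0 : ℤ), (0 : ℤ)) = 0 := by simp [Y, barlowPos]
    rw [if_pos hY, if_pos h0]
  · have hY : Y 1 (i, j, 0) ≠ 0 := by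
      intro h
      have h' := Y_injective one_ne_zero (h.trans (Y_zero 1).symm)
      apply h0
      simp only [Prod.ext_iff, Prod.fst_zero, Prod.snd_zero] at h' ⊢
      exact ⟨h'.1, h'.2.1⟩
    rw [if_neg hY, if_neg h0]
    have hin : inner ℝ (Y 1 (i, j, 0)) e₃ = 0 := by
      rw [inner_e₃, Y_apply_two]; simp
    rw [Hess₀_of_inner_eq_zero hin, norm_e₃, one_pow, mul_one]
    have hr0 : ‖Y 1 (i, j, 0)‖ ≠ 0 := norm_ne_zero_iff.2 hY
    rw [deriv_lennardJones hr0]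
    unfold ψQ
    rw [← norm_sq_Y_planar 1 i j, ← inv_pow, div_eq_mul_inv]
    ring

/-- Reindexing the lattice row sum by labels. [folklore] -/
theorem tsum_Hrow_fccLat_eq {H : ℝ} (hH : H ≠ 0) :
    ∑' y : fccLat a₀_ne_zero hH, Hrow (fccLat a₀_ne_zero hH) e₃ y =
      ∑' n : ℤ × ℤ × ℤ, hr (Y H n) := by
  set L := fccLat a₀_ne_zero hH
  let φ : ℤ × ℤ × ℤ → L := fun n => ⟨Y H n, Y_mem hH n⟩
  have hφ : Function.Injective φ := fun n n' h =>
    Y_injective hH (congrArg (fun y : L => (y : E3)) h)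
  have hsupp : Function.support (Hrow L e₃) ⊆ Set.range φ := by
    intro y _
    obtain ⟨n, hn⟩ := exists_Y_eq hH y.2
    exact ⟨n, Subtype.ext hn⟩
  rw [← hφ.tsum_eq hsupp]
  refine tsum_congr fun n => ?_
  simp only [Hrow, hr, φ, Submodule.mk_eq_zero]

/-- **Second variation of `e₃·𝟙_{0}` on the fcc lattice with layer spacing `H ≥ 1`:**
`hessForm = 2·Σ'_n hr(Y_H(n))`. [folklore] -/
theorem hessForm_e₃_eq {H : ℝ} (hH : 1 ≤ H) :
    hessForm a₀ constHagg (zU H) (uS e₃) = 2 * ∑' n : ℤ × ℤ × ℤ, hr (Y H n) := by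
  have hH0 : H ≠ 0 := by positivity
  have hS := sites_const_zU a₀_ne_zero hH0
  have hmin : ∀ y ∈ fccLat a₀_ne_zero hH0, y ≠ 0 → (1 / 2 : ℝ) ≤ ‖y‖ := by
    intro y hy hy0
    obtain ⟨n, rfl⟩ := exists_Y_eq hH0 hy
    exact half_le_norm_Y hH hy0
  rw [hessForm_single (fccLat a₀_ne_zero hH0) (finrank_fccLat _ _) hS hmin norm_e₃,
    tsum_Hrow_fccLat_eq hH0]

/-- The decoupled-layer limit of the row weights: the basal layer only. [folklore] -/
def gpl (n : ℤ × ℤ × ℤ) : ℝ := if n.2.2 = 0 then hr (Y 1 n) else 0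

/-- **Layer decoupling (Tannery):** as `H → ∞` the row sum of `e₃·𝟙_{0}` on the fcc lattice of
layer spacing `H` tends to its basal-layer part; the other layers are dominated by
`904‖Y_1(n)‖⁻⁸` (summable over the lattice at `H = 1`) and tend to `0` termwise (`‖Y_H(n)‖ ≥ H`).
[folklore] -/
theorem tendsto_tsum_hr :
    Tendsto (fun H : ℝ => ∑' n : ℤ × ℤ × ℤ, hr (Y H n)) atTop (𝓝 (∑' n, gpl n)) := by
  have h_sum : Summable fun n : ℤ × ℤ × ℤ => 904 * (‖Y 1 n‖⁻¹) ^ 8 := by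
    set L := fccLat a₀_ne_zero one_ne_zero
    let φ : ℤ × ℤ × ℤ → L := fun n => ⟨Y 1 n, Y_mem one_ne_zero n⟩
    have hφ : Function.Injective φ := fun n n' h =>
      Y_injective one_ne_zero (congrArg (fun y : L => (y : E3)) h)
    have h8 := ZLattice.summable_norm_sub_inv_pow L 8 (by rw [finrank_fccLat]; norm_num) 0
    have h8' := (h8.comp_injective hφ).mul_left 904
    refine h8'.congr fun n => ?_
    simp [φ]
  refine tendsto_tsum_of_dominated_convergence (f := fun H n => hr (Y H n)) h_sum ?_ ?_
  · intro n
    by_cases hm : n.2.2 = 0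
    · have hc : ∀ H, Y H n = Y 1 n := fun H => by
        obtain ⟨i, j, m⟩ := n
        simp only at hm
        subst hm
        exact Y_planar H i j
      simp only [gpl, if_pos hm, hc]
      exact tendsto_const_nhds
    · simp only [gpl, if_neg hm]
      refine squeeze_zero_norm' ?_ (by simpa using tendsto_inv_atTop_zero.const_mul (904 : ℝ))
      filter_upwards [eventually_ge_atTop (1 : ℝ)] with H hH
      rw [Real.norm_eq_abs]
      have hHle : H ≤ ‖Y H n‖ := le_norm_Y H hm
      have hY0 : Y H n ≠ 0 := by
        intro h0; rw [h0, norm_zero] at hHle; linarith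
      have h1 : |hr (Y H n)| ≤ 904 * (‖Y H n‖⁻¹) ^ 8 := abs_hr_le (Or.inr (half_le_norm_Y hH hY0))
      have hinv : ‖Y H n‖⁻¹ ≤ H⁻¹ := inv_anti₀ (by linarith) hHle
      have hinv1 : ‖Y H n‖⁻¹ ≤ 1 := inv_le_one_of_one_le₀ (le_trans hH hHle)
      have hinv0 : 0 ≤ ‖Y H n‖⁻¹ := inv_nonneg.2 (norm_nonneg _)
      have h8 : (‖Y H n‖⁻¹) ^ 8 ≤ ‖Y H n‖⁻¹ := pow_le_of_le_one hinv0 hinv1 (by norm_num)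
      linarith
  · filter_upwards [eventually_ge_atTop (1 : ℝ)] with H hH
    intro n
    rw [Real.norm_eq_abs]
    by_cases hn : Y H n = 0
    · rw [hn, hr_zero, abs_zero]; positivity
    · have hY1 : Y 1 n ≠ 0 := by
        intro h0
        have : n = 0 := Y_injective one_ne_zero (h0.trans (Y_zero 1).symm)
        subst this
        exact hn (Y_zero H)
      have hpos : 0 < ‖Y 1 n‖ := norm_pos_iff.2 hY1
      have hle : ‖Y H n‖⁻¹ ≤ ‖Y 1 n‖⁻¹ := inv_anti₀ hpos (norm_Y_one_le hH n)
      have hinv0 : 0 ≤ ‖Y H n‖⁻¹ := inv_nonneg.2 (norm_nonneg _)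
      calc |hr (Y H n)| ≤ 904 * (‖Y H n‖⁻¹) ^ 8 := abs_hr_le (Or.inr (half_le_norm_Y hH hn))
        _ ≤ 904 * (‖Y 1 n‖⁻¹) ^ 8 := by gcongr

/-- The limit row sum is the planar transverse sum of part IV-a. [folklore] -/
theorem tsum_gpl_eq : ∑' n, gpl n = ∑' p : ℤ × ℤ, ψpl p := by
  let e : ℤ × ℤ → ℤ × ℤ × ℤ := fun p => (p.1, p.2, 0)
  have he : Function.Injective e := fun p q h => by
    simp only [e, Prod.mk.injEq] at h
    exact Prod.ext h.1 h.2.1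
  have hsupp : Function.support gpl ⊆ Set.range e := by
    intro n hn
    rw [Function.mem_support] at hn
    by_cases hm : n.2.2 = 0
    · refine ⟨(n.1, n.2.1), ?_⟩
      obtain ⟨i, j, m⟩ := n
      simp only at hm
      subst hm
      rfl
    · exact absurd (if_neg hm) hn
  rw [← he.tsum_eq hsupp]
  refine tsum_congr fun p => ?_
  obtain ⟨i, j⟩ := p
  simp only [gpl, e]
  exact hr_Y_planar i j

/-- **Some layer spacing `H ≥ 1` makes the second variation negative.** [folklore] -/
theorem exists_height_tsum_hr_neg : ∃ H : ℝ, 1 ≤ H ∧ ∑' n : ℤ × ℤ × ℤ, hr (Y H n) < 0 := by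
  have hlim := tendsto_tsum_hr
  rw [tsum_gpl_eq] at hlim
  have hneg : ∑' p : ℤ × ℤ, ψpl p < 0 := by linarith [tsum_ψpl_lt]
  have hev : ∀ᶠ H in atTop, ∑' n : ℤ × ℤ × ℤ, hr (Y H n) < 0 := hlim.eventually (gt_mem_nhds hneg)
  obtain ⟨H, hH⟩ := (hev.and (eventually_ge_atTop 1)).exists
  exact ⟨H, hH.2, hH.1⟩

/-- **The UPPER height bound `z(m+1) − z(m) ≤ 17a/20` is load-bearing.**  On the window
`47/50 ≤ a ∧ a ≤ 1 ∧ IsHaggSeq s ∧ ∀ m, 39a/50 ≤ z(m+1) − z(m)` (the crux's `Box` with the upper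
height bound deleted) uniform polytype stability FAILS.  Witness: `a = 47/50`, the fcc word,
uniform heights `H·m` with `H` large (in the window, force balanced by part I), `u = e₃·𝟙_{0}`.
The layers decouple (`tendsto_tsum_hr`, Tannery over the lattice at `H = 1`), and the basal layer
is a biaxially COMPRESSED triangular LJ membrane whose transverse stiffness
`Σ_{η≠0} V′(|η|)/|η|` is `< −3/2` (part IV-a, `tsum_ψpl_lt`: six bonds at `r = 0.94 < 1` give
`6·(−0.7375)`, the rest `≤ +2.6`), so `½·hessForm < 0 ≤ κ·nnForm`.  Physically: without a
ceiling on the layer spacing the "polytype" may be a stack of free membranes, and a compressed free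
LJ membrane buckles.  Numerically the crux at `a = 47/50` already fails at `H ≈ 1.5a`; the
disprover's Bloch scan puts the true edge of the height window at `h ≈ 0.91a` (`a = 1`).
[folklore] -/
theorem uniformPolytypeStability_false_without_heightUpper :
    ¬ UniformPolytypeStabilityOn fun a s z => 47 / 50 ≤ a ∧ a ≤ 1 ∧ IsHaggSeq s ∧
      ∀ m : ℤ, 39 / 50 * a ≤ z (m + 1) - z m := by
  rintro ⟨κ, hκ, h⟩
  obtain ⟨H, hH1, hneg⟩ := exists_height_tsum_hr_neg
  have hH0 : H ≠ 0 := by positivity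
  set L := fccLat a₀_ne_zero hH0
  have hS : Sites a₀ constHagg (zU H) = (L : Set E3) := sites_const_zU a₀_ne_zero hH0
  have hW : 47 / 50 ≤ a₀ ∧ a₀ ≤ 1 ∧ IsHaggSeq constHagg ∧
      ∀ m : ℤ, 39 / 50 * a₀ ≤ zU H (m + 1) - zU H m := by
    refine ⟨by unfold a₀; norm_num, by unfold a₀; norm_num, isHaggSeq_const, fun m => ?_⟩
    rw [zU_succ_sub]; unfold a₀; linarith
  have hF : ForceBalanced a₀ constHagg (zU H) :=
    forceBalanced_of_sites_eq L (finrank_fccLat _ _) hS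
  have hsupp : Function.support (uS e₃) ⊆ Sites a₀ constHagg (zU H) :=
    (support_uS e₃).trans (by
      intro p hp
      rw [Set.mem_singleton_iff] at hp
      subst hp
      rw [hS]
      exact L.zero_mem)
  have key := h a₀ constHagg (zU H) hW hF (uS e₃) (finite_support_uS e₃) hsupp
  rw [hessForm_e₃_eq hH1] at key
  have hnn := mul_nonneg hκ.le (nnForm_nonneg a₀ constHagg (zU H) (uS e₃))
  linarith

end HeightUpper

/-! ## Part V′ — the Hägg condition `IsHaggSeq s` is load-bearing (AAA stacking; PROVED) -/

section Hagg

open Summit.AtomisticToContinuum.Crystallization.Theorems.UniformPolytypeStabilityNegative Real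

/-- The zero word labels every layer `A`: `haggLabel 0 ≡ 0`. [folklore] -/
@[simp] theorem haggLabel_zero_fun (m : ℤ) : haggLabel (0 : ℤ → ℤ) m = 0 := by
  simp [haggLabel, haggWindow]

/-- The simple-hexagonal Bravais lattice `ℤu_a + ℤv_a + ℤ(h e₃)` (the tree's Barlow period
lattice of the ZERO word, period `1`). [folklore] -/
def shLat {a h : ℝ} (ha : a ≠ 0) (hh : h ≠ 0) : Submodule ℤ E3 :=
  barlowPeriodLattice 0 ha hh one_ne_zero

/-- The simple-hexagonal lattice is discrete. [folklore] -/
instance {a h : ℝ} (ha : a ≠ 0) (hh : h ≠ 0) : DiscreteTopology (shLat ha hh) := by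
  unfold shLat barlowPeriodLattice; infer_instance

/-- The simple-hexagonal lattice is a full lattice. [folklore] -/
instance {a h : ℝ} (ha : a ≠ 0) (hh : h ≠ 0) : IsZLattice ℝ (shLat ha hh) := by
  unfold shLat barlowPeriodLattice; infer_instance

/-- `rank shLat = 3`. [folklore] -/
theorem finrank_shLat {a h : ℝ} (ha : a ≠ 0) (hh : h ≠ 0) :
    Module.finrank ℤ (shLat ha hh) = 3 := by
  rw [ZLattice.rank ℝ (shLat ha hh), finrank_euclideanSpace, Fintype.card_fin]

/-- Membership in the simple-hexagonal lattice: `i u + j v + m h e₃`. [folklore] -/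
theorem mem_shLat_iff {a h : ℝ} (ha : a ≠ 0) (hh : h ≠ 0) (g : E3) :
    g ∈ shLat ha hh ↔ ∃ m i j : ℤ, g = (i : ℝ) • triangularVec₁ a + (j : ℝ) • triangularVec₂ a +
      (m : ℝ) • layerNormal h := by
  have key : ∀ m : ℤ, (m : ℝ) • ((haggWindow (0 : ℤ → ℤ) 0 1 : ℝ) • barlowOffset a +
      ((1 : ℕ) : ℝ) • layerNormal h) = (m : ℝ) • layerNormal h := by
    intro m; simp [haggWindow]
  constructor
  · intro hg
    obtain ⟨n₀, n₁, n₂, rfl⟩ :=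
      exists_eq_of_mem_barlowPeriodLattice (0 : ℤ → ℤ) ha hh one_ne_zero hg
    exact ⟨n₂, n₀, n₁, by rw [key]⟩
  · rintro ⟨m, i, j, rfl⟩
    have := sum_smul_mem_barlowPeriodLattice (0 : ℤ → ℤ) ha hh one_ne_zero i j m
    rwa [key] at this

/-- **For the zero word and uniform heights the site set is the simple-hexagonal lattice**
(AAA stacking). [folklore] -/
theorem sites_zero_zU {a h : ℝ} (ha : a ≠ 0) (hh : h ≠ 0) :
    Sites a 0 (zU h) = (shLat ha hh : Set E3) := by
  ext g
  rw [SetLike.mem_coe, mem_shLat_iff]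
  simp only [Sites, Set.mem_setOf_eq, haggLabel_zero_fun, Int.cast_zero, zero_smul, add_zero, zU]
  constructor
  · rintro ⟨m, i, j, rfl⟩
    exact ⟨m, i, j, by rw [smul_layerNormal, smul_layerNormal, mul_one, mul_comm]⟩
  · rintro ⟨m, i, j, rfl⟩
    exact ⟨m, i, j, by rw [smul_layerNormal, smul_layerNormal, mul_one, mul_comm]⟩

/-- Lattice vectors are points of the AAA stacking. [folklore] -/
theorem mem_stacking_of_mem_shLat {a h : ℝ} (ha : a ≠ 0) (hh : h ≠ 0) {g : E3}
    (hg : g ∈ shLat ha hh) : g ∈ barlowStacking a h 0 := by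
  obtain ⟨m, i, j, rfl⟩ := (mem_shLat_iff ha hh g).1 hg
  exact ⟨m, i, j, by simp [barlowPos]⟩

/-- Nonzero vectors of the AAA lattice are long: `‖g‖ ≥ min a h`. [folklore] -/
theorem min_le_norm_of_mem_shLat {a h : ℝ} (ha : 0 < a) (hh : 0 < h) {g : E3}
    (hg : g ∈ shLat ha.ne' hh.ne') (hg0 : g ≠ 0) : min a h ≤ ‖g‖ := by
  have h0 : (0 : E3) ∈ barlowStacking a h 0 := ⟨0, 0, 0, by simp [barlowPos]⟩
  have := le_dist_of_mem_barlowStacking a h 0 ha.le hh.le h0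
    (mem_stacking_of_mem_shLat ha.ne' hh.ne' hg) hg0.symm
  rwa [dist_eq_norm, zero_sub, norm_neg] at this

/-! ### The witness lattice: `a = a₀ = 47/50`, `h = h₀ = 39a₀/50` -/

/-- The lower edge of the height window at `a₀`: `h₀ = 39a₀/50 = 0.7332`. [folklore] -/
def h₀ : ℝ := 39 / 50 * a₀

/-- Labels of the AAA lattice: `Y₀(i,j,m) = i u + j v + m h₀ e₃`. [folklore] -/
def Y₀ (n : ℤ × ℤ × ℤ) : E3 := barlowPos a₀ h₀ 0 n.2.2 n.1 n.2.1

/-- First coordinate. [folklore] -/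
theorem Y₀_apply_zero (n : ℤ × ℤ × ℤ) : Y₀ n 0 = a₀ * (n.1 + n.2.1 / 2) := by
  simp [Y₀]

/-- Second coordinate. [folklore] -/
theorem Y₀_apply_one (n : ℤ × ℤ × ℤ) : Y₀ n 1 = a₀ * √3 / 2 * n.2.1 := by
  simp [Y₀]

/-- Third coordinate. [folklore] -/
theorem Y₀_apply_two (n : ℤ × ℤ × ℤ) : Y₀ n 2 = n.2.2 * h₀ := by
  simp [Y₀]

/-- `Y₀ 0 = 0`. [folklore] -/
theorem Y₀_zero : Y₀ 0 = 0 := by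
  simp [Y₀, barlowPos]

/-- `a₀ ≠ 0`, `h₀ ≠ 0`. [folklore] -/
theorem a₀_ne_zero' : a₀ ≠ 0 ∧ h₀ ≠ 0 := by
  unfold h₀ a₀; norm_num

/-- `Y₀(n)` is a lattice vector. [folklore] -/
theorem Y₀_mem (n : ℤ × ℤ × ℤ) : Y₀ n ∈ shLat a₀_ne_zero'.1 a₀_ne_zero'.2 :=
  (mem_shLat_iff _ _ _).2 ⟨n.2.2, n.1, n.2.1, by simp [Y₀, barlowPos]⟩

/-- Every lattice vector is labelled. [folklore] -/
theorem exists_Y₀_eq {g : E3} (hg : g ∈ shLat a₀_ne_zero'.1 a₀_ne_zero'.2) : ∃ n, Y₀ n = g := by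
  obtain ⟨m, i, j, rfl⟩ := (mem_shLat_iff _ _ g).1 hg
  exact ⟨(i, j, m), by simp [Y₀, barlowPos]⟩

/-- Labels are unique. [folklore] -/
theorem Y₀_injective : Function.Injective Y₀ := by
  rintro ⟨i, j, m⟩ ⟨i', j', m'⟩ h
  have h2 := congrArg (fun x : E3 => x 2) h
  have h1 := congrArg (fun x : E3 => x 1) h
  have h0 := congrArg (fun x : E3 => x 0) h
  simp only [Y₀_apply_two, Y₀_apply_one, Y₀_apply_zero] at h0 h1 h2
  have ha : (0 : ℝ) < a₀ := by unfold a₀; norm_num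
  have hh : h₀ ≠ 0 := a₀_ne_zero'.2
  have h3 : (0 : ℝ) < √3 := Real.sqrt_pos.2 (by norm_num)
  have hm : (m : ℝ) = m' := mul_right_cancel₀ hh h2
  have hj : (j : ℝ) = j' := mul_left_cancel₀ (show a₀ * √3 / 2 ≠ 0 by positivity) h1
  have hi : (i : ℝ) = i' := by
    have := mul_left_cancel₀ ha.ne' h0
    linarith
  have hm' : m = m' := by exact_mod_cast hm
  have hj' : j = j' := by exact_mod_cast hj
  have hi' : i = i' := by exact_mod_cast hi
  rw [hm', hj', hi']

/-- `‖Y₀(i,j,m)‖² = a₀²(i² + ij + j²) + m²h₀²`. [folklore] -/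
theorem norm_sq_Y₀ (n : ℤ × ℤ × ℤ) :
    ‖Y₀ n‖ ^ 2 = a₀ ^ 2 * (Qf (n.1, n.2.1) : ℝ) + (n.2.2 : ℝ) ^ 2 * h₀ ^ 2 := by
  have h3 : (√3 : ℝ) ^ 2 = 3 := Real.sq_sqrt (by norm_num)
  rw [EuclideanSpace.norm_sq_eq, Fin.sum_univ_three, Y₀_apply_zero, Y₀_apply_one, Y₀_apply_two]
  simp only [Real.norm_eq_abs, sq_abs, Qf]
  push_cast
  linear_combination (a₀ ^ 2 * (n.2.1 : ℝ) ^ 2 / 4) * h3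

/-- Nonzero labelled vectors are at least `1/2` long (`min a₀ h₀ = h₀ = 0.7332`). [folklore] -/
theorem half_le_norm_Y₀ {n : ℤ × ℤ × ℤ} (hn : Y₀ n ≠ 0) : (1 / 2 : ℝ) ≤ ‖Y₀ n‖ := by
  have ha : (0 : ℝ) < a₀ := by unfold a₀; norm_num
  have hh : (0 : ℝ) < h₀ := by unfold h₀ a₀; norm_num
  have h := min_le_norm_of_mem_shLat ha hh (Y₀_mem n) hn
  have : (1 / 2 : ℝ) ≤ min a₀ h₀ := le_min (by unfold a₀; norm_num) (by unfold h₀ a₀; norm_num)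
  linarith

/-! ### The row function of `e₁·𝟙_{0}` as a rational function of `(x₁², |x|²)` -/

/-- The in-plane unit vector `e₁`. [folklore] -/
def ex₁ : E3 := EuclideanSpace.single 0 (1 : ℝ)

/-- `‖e₁‖ = 1`. [folklore] -/
theorem norm_ex₁ : ‖ex₁‖ = 1 := by
  rw [ex₁, PiLp.norm_single, norm_one]

/-- `⟪x, e₁⟫ = x₁`. [folklore] -/
theorem inner_ex₁ (x : E3) : inner ℝ x ex₁ = x 0 := by
  rw [ex₁, EuclideanSpace.inner_single_right]; simp

/-- `e₁ᵀK(x)e₁ = V″(r)c² + (V′(r)/r)(1 − c²)` written in `p = x₁²`, `q = r²` (`c² = p/q`):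
`T(p,q) = (13q⁻⁷ − 7q⁻⁴)(p/q) + (−q⁻⁷ + q⁻⁴)(1 − p/q)`. [folklore] -/
def TQ (p q : ℝ) : ℝ :=
  (13 * (q⁻¹) ^ 7 - 7 * (q⁻¹) ^ 4) * (p / q) + (-(q⁻¹) ^ 7 + (q⁻¹) ^ 4) * (1 - p / q)

/-- The same rational function over `ℚ` (for kernel evaluation of the near field). [folklore] -/
def TQq (p q : ℚ) : ℚ :=
  (13 * (q⁻¹) ^ 7 - 7 * (q⁻¹) ^ 4) * (p / q) + (-(q⁻¹) ^ 7 + (q⁻¹) ^ 4) * (1 - p / q)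

/-- `T` over `ℚ` casts to `T` over `ℝ`. [folklore] -/
theorem cast_TQq (p q : ℚ) : ((TQq p q : ℚ) : ℝ) = TQ p q := by
  unfold TQq TQ; push_cast; ring

/-- `e₁ᵀK(x)e₁ = T(x₁², |x|²)` for `x ≠ 0`. [folklore] -/
theorem Hess₀_ex₁_eq {x : E3} (hx : x ≠ 0) : Hess₀ x ex₁ = TQ ((x 0) ^ 2) (‖x‖ ^ 2) := by
  have hr : ‖x‖ ≠ 0 := norm_ne_zero_iff.2 hx
  unfold Hess₀ TQ
  rw [deriv_deriv_lennardJones hr, deriv_lennardJones hr, inner_ex₁, norm_ex₁]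
  field_simp

/-- One-sided far-field bound: for `0 ≤ p ≤ q` and `q ≥ 4` (so `13q⁻⁷ ≤ q⁻⁴`), `T(p,q) ≤ q⁻⁴`.
[folklore] -/
theorem TQ_le {p q : ℝ} (hp0 : 0 ≤ p) (hpq : p ≤ q) (h4 : 4 ≤ q) : TQ p q ≤ (q⁻¹) ^ 4 := by
  have hq : 0 < q := by linarith
  have h13 : 13 ≤ q ^ 3 := by
    have h16 : 16 ≤ q ^ 2 := by nlinarith
    nlinarith [mul_nonneg (sub_nonneg.2 h4) (sq_nonneg q)]
  set A : ℝ := (q⁻¹) ^ 7 with hA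
  set B : ℝ := (q⁻¹) ^ 4 with hB
  set t : ℝ := p / q with ht
  have hA0 : 0 ≤ A := by positivity
  have hB0 : 0 ≤ B := by positivity
  have ht0 : 0 ≤ t := by positivity
  have ht1 : t ≤ 1 := (div_le_one hq).2 hpq
  have hAB : 13 * A ≤ B := by
    have hq0 : q ≠ 0 := hq.ne'
    have e : B = A * q ^ 3 := by rw [hA, hB]; field_simp
    rw [e]; nlinarith
  have h1 : 13 * A * t ≤ B * t := mul_le_mul_of_nonneg_right hAB ht0
  have h2 : 0 ≤ B * t := mul_nonneg hB0 ht0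
  have h3 : 0 ≤ A * (1 - t) := mul_nonneg hA0 (by linarith)
  have e : TQ p q = (13 * A - 7 * B) * t + (-A + B) * (1 - t) := rfl
  rw [e]; nlinarith

/-! ### The near field: `|n|_∞ ≤ 2` evaluated exactly over `ℚ` -/

/-- `a₀²` and `h₀²` over `ℚ`. [folklore] -/
def a2q : ℚ := (47 / 50) ^ 2

/-- `h₀²` over `ℚ`. [folklore] -/
def h2q : ℚ := (39 / 50) ^ 2 * a2q

/-- `x₁²` of the label `n` over `ℚ`. [folklore] -/
def pOf (n : ℤ × ℤ × ℤ) : ℚ := a2q * ((2 * n.1 + n.2.1 : ℚ) / 2) ^ 2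

/-- `|x|²` of the label `n` over `ℚ`. [folklore] -/
def qOf (n : ℤ × ℤ × ℤ) : ℚ := a2q * (n.1 ^ 2 + n.1 * n.2.1 + n.2.1 ^ 2 : ℚ) + (n.2.2 : ℚ) ^ 2 * h2q

/-- The near block `{|i|,|j|,|m| ≤ 2} ∖ {0}` (124 labels). [folklore] -/
def blockFin : Finset (ℤ × ℤ × ℤ) :=
  (Finset.Icc (-2 : ℤ) 2 ×ˢ Finset.Icc (-2 : ℤ) 2 ×ˢ Finset.Icc (-2 : ℤ) 2).erase 0

/-- **Exact near field** (kernel evaluation over `ℚ`): `Σ_{0<|n|_∞≤2} T = −75.86… < −758/10`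
(two vertical bonds `2V′(h₀)/h₀ = −130.19`, six in-plane `+56.08`, the rest `−1.75`). [folklore] -/
theorem near_sum_lt : (∑ n ∈ blockFin, TQq (pOf n) (qOf n)) < -758 / 10 := by
  decide +kernel

/-- `pOf` is the squared first coordinate. [folklore] -/
theorem cast_pOf (n : ℤ × ℤ × ℤ) : ((pOf n : ℚ) : ℝ) = (Y₀ n 0) ^ 2 := by
  rw [Y₀_apply_zero]; unfold pOf a2q a₀; push_cast; ring

/-- `qOf` is the squared norm. [folklore] -/
theorem cast_qOf (n : ℤ × ℤ × ℤ) : ((qOf n : ℚ) : ℝ) = ‖Y₀ n‖ ^ 2 := by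
  rw [norm_sq_Y₀]; unfold qOf h2q a2q h₀ a₀ Qf; push_cast; ring

/-- The row function `x ↦ e₁ᵀK(x)e₁` (`0` at the origin). [folklore] -/
def hx (x : E3) : ℝ := if x = 0 then 0 else Hess₀ x ex₁

/-- Labels off the origin are nonzero vectors. [folklore] -/
theorem Y₀_ne_zero {n : ℤ × ℤ × ℤ} (hn : n ≠ 0) : Y₀ n ≠ 0 := fun h =>
  hn (Y₀_injective (h.trans Y₀_zero.symm))

/-- On a label `n ≠ 0` the row function is the cast of the rational value. [folklore] -/
theorem hx_Y₀ {n : ℤ × ℤ × ℤ} (hn : n ≠ 0) : hx (Y₀ n) = ((TQq (pOf n) (qOf n) : ℚ) : ℝ) := by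
  rw [cast_TQq, cast_pOf, cast_qOf, hx, if_neg (Y₀_ne_zero hn), Hess₀_ex₁_eq (Y₀_ne_zero hn)]

/-- The near part of the row function. [folklore] -/
def Tnear (n : ℤ × ℤ × ℤ) : ℝ := if n ∈ blockFin then hx (Y₀ n) else 0

/-- The far part of the row function. [folklore] -/
def Tfar (n : ℤ × ℤ × ℤ) : ℝ := if n = 0 ∨ n ∈ blockFin then 0 else hx (Y₀ n)

/-- Row = near + far. [folklore] -/
theorem hx_eq_add (n : ℤ × ℤ × ℤ) : hx (Y₀ n) = Tnear n + Tfar n := by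
  unfold Tnear Tfar
  by_cases h0 : n = 0
  · subst h0; simp [hx, Y₀_zero, blockFin]
  · by_cases hb : n ∈ blockFin <;> simp [hb, h0]

/-- The near part has `HasSum < −75.8`. [folklore] -/
theorem hasSum_Tnear : ∃ S : ℝ, HasSum Tnear S ∧ S < -758 / 10 := by
  refine ⟨∑ n ∈ blockFin, Tnear n, hasSum_sum_of_ne_finset_zero fun n hn => if_neg hn, ?_⟩
  have he : ∑ n ∈ blockFin, Tnear n = ((∑ n ∈ blockFin, TQq (pOf n) (qOf n) : ℚ) : ℝ) := by
    rw [Rat.cast_sum]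
    refine Finset.sum_congr rfl fun n hn => ?_
    have hn0 : n ≠ 0 := (Finset.mem_erase.1 hn).1
    rw [Tnear, if_pos hn, hx_Y₀ hn0]
  rw [he]
  exact_mod_cast near_sum_lt

/-! ### The far field: three slab majorants -/

/-- Quadratic weight `w_c(n) = c·n⁻²` off the origin, `1` at the origin. [folklore] -/
def w2 (c : ℝ) (n : ℤ) : ℝ := if n = 0 then 1 else c * ((n : ℝ) ^ 2)⁻¹

/-- `w_c ≥ 0` for `c ≥ 0`. [folklore] -/
theorem w2_nonneg {c : ℝ} (hc : 0 ≤ c) (n : ℤ) : 0 ≤ w2 c n := by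
  unfold w2; split_ifs <;> positivity

/-- `Σ_{n∈ℤ} w_c(n) = 1 + 2c·π²/6`. [folklore] -/
theorem hasSum_w2 (c : ℝ) : HasSum (w2 c) (1 + 2 * c * (π ^ 2 / 6)) := by
  have hA : HasSum (fun n : ℕ => w2 c n) (c * (π ^ 2 / 6) + 1) := by
    have h1 : (fun n : ℕ => w2 c n) =
        fun n : ℕ => c * (1 / (n : ℝ) ^ 2) + if n = 0 then 1 else 0 := by
      funext n
      rcases eq_or_ne n 0 with rfl | hn
      · simp [w2]
      · simp [w2, hn, one_div]
    rw [h1]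
    exact (hasSum_zeta_two.mul_left c).add (hasSum_ite_eq 0 1)
  have hB : HasSum (fun n : ℕ => w2 c (-(n + 1 : ℤ))) (c * (π ^ 2 / 6)) := by
    have h := (hasSum_nat_add_iff' 1).2 hasSum_zeta_two
    simp only [Finset.sum_range_one, Nat.cast_zero, ne_eq, OfNat.ofNat_ne_zero,
      not_false_eq_true, zero_pow, div_zero, sub_zero] at h
    have he : (fun n : ℕ => w2 c (-(n + 1 : ℤ))) =
        fun n : ℕ => c * (1 / ((n + 1 : ℕ) : ℝ) ^ 2) := by
      funext n
      have hne : (-(n + 1 : ℤ)) ≠ 0 := by omega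
      simp only [w2, hne, if_false, one_div]
      push_cast
      ring
    rw [he]
    exact h.mul_left c
  have := hA.of_nat_of_neg_add_one hB
  convert this using 1
  ring

/-- `‖w_c‖` is summable. [folklore] -/
theorem summable_norm_w2 (c : ℝ) : Summable fun n => ‖w2 c n‖ := by
  simpa only [Real.norm_eq_abs] using (hasSum_w2 c).summable.abs

/-- `Σ w_c ≤ 1 + 2c·(1654/1000)` (`π < 3.15`). [folklore] -/
theorem tsum_w2_le {c : ℝ} (hc : 0 ≤ c) : ∑' n, w2 c n ≤ 1 + 2 * c * (1654 / 1000) := by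
  rw [(hasSum_w2 c).tsum_eq]
  have hπ := Real.pi_lt_d2
  have h2 : π ^ 2 < (3.15 : ℝ) ^ 2 := by gcongr
  have h6 : π ^ 2 / 6 ≤ 1654 / 1000 := by norm_num at h2 ⊢; linarith
  have : 0 ≤ 2 * c := by positivity
  nlinarith

/-- In-plane weight constant `4/(3a₀²)`, height weight constant `h₀⁻²`, slab constants
`K₁ = 16/(9a₀⁴)`, `K₂ = h₀⁻⁴`. [folklore] -/
def cA : ℝ := 4 / (3 * a₀ ^ 2)

/-- `h₀⁻²`. [folklore] -/
def cH : ℝ := (h₀ ^ 2)⁻¹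

/-- The far-field majorant: `i`-slab + `j`-slab + `m`-slab. [folklore] -/
def Bmaj3 (n : ℤ × ℤ × ℤ) : ℝ :=
  cA ^ 2 * (t4 n.1 * (w2 cA n.2.1 * w2 cH n.2.2)) +
    cA ^ 2 * (w2 cA n.1 * (t4 n.2.1 * w2 cH n.2.2)) +
    cH ^ 2 * (w2 cA n.1 * (w2 cA n.2.1 * t4 n.2.2))

/-- Positivity of the constants. [folklore] -/
theorem cA_pos : 0 < cA ∧ 0 < cH := by
  unfold cA cH h₀ a₀; norm_num

/-- The majorant is `≥ 0` termwise, part by part. [folklore] -/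
theorem Bmaj3_parts_nonneg (n : ℤ × ℤ × ℤ) :
    0 ≤ cA ^ 2 * (t4 n.1 * (w2 cA n.2.1 * w2 cH n.2.2)) ∧
      0 ≤ cA ^ 2 * (w2 cA n.1 * (t4 n.2.1 * w2 cH n.2.2)) ∧
        0 ≤ cH ^ 2 * (w2 cA n.1 * (w2 cA n.2.1 * t4 n.2.2)) := by
  have hA := w2_nonneg cA_pos.1.le
  have hH := w2_nonneg cA_pos.2.le
  exact ⟨by have := t4_nonneg n.1; have := hA n.2.1; have := hH n.2.2; positivity,
    by have := t4_nonneg n.2.1; have := hA n.1; have := hH n.2.2; positivity,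
    by have := t4_nonneg n.2.2; have := hA n.1; have := hA n.2.1; positivity⟩

/-- `q⁻¹ ≤ w_{cA}(j)` when `q ≥ 1` and `q ≥ (3a₀²/4)j²`. [folklore] -/
theorem inv_le_w2_cA {q : ℝ} {j : ℤ} (hq1 : 1 ≤ q) (hqj : 3 * a₀ ^ 2 / 4 * (j : ℝ) ^ 2 ≤ q) :
    q⁻¹ ≤ w2 cA j := by
  unfold w2 cA
  split_ifs with hj
  · exact inv_le_one_of_one_le₀ hq1
  · have hj2 : (0 : ℝ) < (j : ℝ) ^ 2 := by positivity
    have ha : (0 : ℝ) < a₀ ^ 2 := by unfold a₀; norm_num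
    rw [show 4 / (3 * a₀ ^ 2) * ((j : ℝ) ^ 2)⁻¹ = (3 * a₀ ^ 2 / 4 * (j : ℝ) ^ 2)⁻¹ by
      field_simp]
    exact inv_anti₀ (by positivity) hqj

/-- `q⁻¹ ≤ w_{cH}(m)` when `q ≥ 1` and `q ≥ h₀²m²`. [folklore] -/
theorem inv_le_w2_cH {q : ℝ} {m : ℤ} (hq1 : 1 ≤ q) (hqm : (m : ℝ) ^ 2 * h₀ ^ 2 ≤ q) :
    q⁻¹ ≤ w2 cH m := by
  unfold w2 cH
  split_ifs with hm
  · exact inv_le_one_of_one_le₀ hq1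
  · have hm2 : (0 : ℝ) < (m : ℝ) ^ 2 := by positivity
    have hh : (0 : ℝ) < h₀ ^ 2 := by unfold h₀ a₀; norm_num
    rw [show (h₀ ^ 2)⁻¹ * ((m : ℝ) ^ 2)⁻¹ = ((m : ℝ) ^ 2 * h₀ ^ 2)⁻¹ by
      rw [mul_inv, mul_comm]]
    exact inv_anti₀ (by positivity) hqm

/-- `q⁻² ≤ c²·t(i)` when `|i| ≥ 3` and `q ≥ c⁻¹ i²` (`c > 0`). [folklore] -/
theorem inv_sq_le_t4 {q c : ℝ} {i : ℤ} (hc : 0 < c) (hi : 3 ≤ |i|) (hqi : c⁻¹ * (i : ℝ) ^ 2 ≤ q) :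
    (q⁻¹) ^ 2 ≤ c ^ 2 * t4 i := by
  unfold t4
  rw [if_pos hi]
  have hi0 : i ≠ 0 := by intro h; rw [h, abs_zero] at hi; norm_num at hi
  have hi2 : (0 : ℝ) < (i : ℝ) ^ 2 := by positivity
  have hpos : 0 < c⁻¹ * (i : ℝ) ^ 2 := by positivity
  have h1 : q⁻¹ ≤ (c⁻¹ * (i : ℝ) ^ 2)⁻¹ := inv_anti₀ hpos hqi
  have h0 : 0 ≤ q⁻¹ := inv_nonneg.2 (hpos.le.trans hqi)
  calc (q⁻¹) ^ 2 ≤ ((c⁻¹ * (i : ℝ) ^ 2)⁻¹) ^ 2 := pow_le_pow_left₀ h0 h1 2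
    _ = c ^ 2 * ((i : ℝ) ^ 4)⁻¹ := by field_simp

/-- `|i| ≥ 3 ⟹ i² ≥ 9` (cast to `ℝ`). [folklore] -/
theorem nine_le_sq_of_abs {i : ℤ} (hi : 3 ≤ |i|) : (9 : ℝ) ≤ (i : ℝ) ^ 2 := by
  have h : (3 : ℤ) * 3 ≤ |i| * |i| := mul_le_mul hi hi (by norm_num) (abs_nonneg i)
  rw [abs_mul_abs_self] at h
  have h' : (9 : ℤ) ≤ i ^ 2 := by rw [sq]; linarith
  exact_mod_cast h'

/-- Slab lower bounds for `q = ‖Y₀(i,j,m)‖²`: `q ≥ (3a₀²/4)i²`, `(3a₀²/4)j²`, `h₀²m²`, and `q ≥ 4`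
outside the block. [folklore] -/
theorem slab_bounds (i j m : ℤ) :
    3 * a₀ ^ 2 / 4 * (i : ℝ) ^ 2 ≤ ‖Y₀ (i, j, m)‖ ^ 2 ∧
      3 * a₀ ^ 2 / 4 * (j : ℝ) ^ 2 ≤ ‖Y₀ (i, j, m)‖ ^ 2 ∧
      (m : ℝ) ^ 2 * h₀ ^ 2 ≤ ‖Y₀ (i, j, m)‖ ^ 2 ∧
      (3 ≤ |i| ∨ 3 ≤ |j| ∨ 3 ≤ |m| → 4 ≤ ‖Y₀ (i, j, m)‖ ^ 2) := by
  rw [norm_sq_Y₀]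
  dsimp only
  have hA2 : a₀ ^ 2 = 2209 / 2500 := by unfold a₀; norm_num
  have hH2 : h₀ ^ 2 = 3359889 / 6250000 := by unfold h₀ a₀; norm_num
  have hQi := sq_fst_le_Qf (i, j)
  have hQj := sq_snd_le_Qf (i, j)
  dsimp only at hQi hQj
  have hQ0 : (0 : ℝ) ≤ (Qf (i, j) : ℝ) := by nlinarith [sq_nonneg (i : ℝ)]
  have hm2 : (0 : ℝ) ≤ (m : ℝ) ^ 2 := sq_nonneg _
  rw [hA2, hH2]
  refine ⟨by linarith, by linarith, by linarith, ?_⟩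
  rintro (hi | hj | hm)
  · have := nine_le_sq_of_abs hi; linarith
  · have := nine_le_sq_of_abs hj; linarith
  · have := nine_le_sq_of_abs hm; linarith

/-- Outside the block `q⁻⁴` is dominated by the three slab terms. [folklore] -/
theorem inv_pow_four_le_slabs {i j m : ℤ} (hout : 3 ≤ |i| ∨ 3 ≤ |j| ∨ 3 ≤ |m|) :
    ((‖Y₀ (i, j, m)‖ ^ 2)⁻¹) ^ 4 ≤ cA ^ 2 * (t4 i * (w2 cA j * w2 cH m)) +
      cA ^ 2 * (w2 cA i * (t4 j * w2 cH m)) + cH ^ 2 * (w2 cA i * (w2 cA j * t4 m)) := by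
  obtain ⟨hB1, hB2, hB3⟩ := Bmaj3_parts_nonneg (i, j, m)
  dsimp only at hB1 hB2 hB3
  obtain ⟨hqi, hqj, hqm, h4⟩ := slab_bounds i j m
  have hq4 := h4 hout
  set q : ℝ := ‖Y₀ (i, j, m)‖ ^ 2
  have hq1 : 1 ≤ q := by linarith
  have hi0 : 0 ≤ q⁻¹ := inv_nonneg.2 (by linarith)
  have hwA := w2_nonneg cA_pos.1.le
  have e4 : (q⁻¹) ^ 4 = (q⁻¹) ^ 2 * (q⁻¹ * q⁻¹) := by ring
  rw [e4]
  have hcAinv : cA⁻¹ = 3 * a₀ ^ 2 / 4 := by unfold cA; rw [inv_div]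
  rcases hout with hi | hj | hm
  · have h1 : (q⁻¹) ^ 2 ≤ cA ^ 2 * t4 i := inv_sq_le_t4 cA_pos.1 hi (by rw [hcAinv]; exact hqi)
    have h2 : q⁻¹ * q⁻¹ ≤ w2 cA j * w2 cH m :=
      mul_le_mul (inv_le_w2_cA hq1 hqj) (inv_le_w2_cH hq1 hqm) hi0 (hwA j)
    have h3 := mul_le_mul h1 h2 (by positivity) (by have := t4_nonneg i; positivity)
    calc (q⁻¹) ^ 2 * (q⁻¹ * q⁻¹) ≤ cA ^ 2 * t4 i * (w2 cA j * w2 cH m) := h3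
      _ = cA ^ 2 * (t4 i * (w2 cA j * w2 cH m)) := by ring
      _ ≤ _ := by linarith
  · have h1 : (q⁻¹) ^ 2 ≤ cA ^ 2 * t4 j := inv_sq_le_t4 cA_pos.1 hj (by rw [hcAinv]; exact hqj)
    have h2 : q⁻¹ * q⁻¹ ≤ w2 cA i * w2 cH m :=
      mul_le_mul (inv_le_w2_cA hq1 hqi) (inv_le_w2_cH hq1 hqm) hi0 (hwA i)
    have h3 := mul_le_mul h1 h2 (by positivity) (by have := t4_nonneg j; positivity)
    calc (q⁻¹) ^ 2 * (q⁻¹ * q⁻¹) ≤ cA ^ 2 * t4 j * (w2 cA i * w2 cH m) := h3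
      _ = cA ^ 2 * (w2 cA i * (t4 j * w2 cH m)) := by ring
      _ ≤ _ := by linarith
  · have hcH : cH⁻¹ * (m : ℝ) ^ 2 = (m : ℝ) ^ 2 * h₀ ^ 2 := by unfold cH; rw [inv_inv, mul_comm]
    have h1 : (q⁻¹) ^ 2 ≤ cH ^ 2 * t4 m := inv_sq_le_t4 cA_pos.2 hm (by rw [hcH]; exact hqm)
    have h2 : q⁻¹ * q⁻¹ ≤ w2 cA i * w2 cA j :=
      mul_le_mul (inv_le_w2_cA hq1 hqi) (inv_le_w2_cA hq1 hqj) hi0 (hwA i)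
    have h3 := mul_le_mul h1 h2 (by positivity) (by have := t4_nonneg m; positivity)
    calc (q⁻¹) ^ 2 * (q⁻¹ * q⁻¹) ≤ cH ^ 2 * t4 m * (w2 cA i * w2 cA j) := h3
      _ = cH ^ 2 * (w2 cA i * (w2 cA j * t4 m)) := by ring
      _ ≤ _ := by linarith

/-- **Far-field domination:** `Tfar ≤ Bmaj3` termwise. [folklore] -/
theorem Tfar_le_Bmaj3 (n : ℤ × ℤ × ℤ) : Tfar n ≤ Bmaj3 n := by
  obtain ⟨i, j, m⟩ := n
  obtain ⟨hB1, hB2, hB3⟩ := Bmaj3_parts_nonneg (i, j, m)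
  dsimp only at hB1 hB2 hB3
  show Tfar (i, j, m) ≤ cA ^ 2 * (t4 i * (w2 cA j * w2 cH m)) +
      cA ^ 2 * (w2 cA i * (t4 j * w2 cH m)) + cH ^ 2 * (w2 cA i * (w2 cA j * t4 m))
  unfold Tfar
  by_cases h : ((i, j, m) : ℤ × ℤ × ℤ) = 0 ∨ ((i, j, m) : ℤ × ℤ × ℤ) ∈ blockFin
  · rw [if_pos h]; linarith
  rw [if_neg h]
  push Not at h
  obtain ⟨hn0, hnb⟩ := h
  have hout : 3 ≤ |i| ∨ 3 ≤ |j| ∨ 3 ≤ |m| := by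
    by_contra hc
    push Not at hc
    obtain ⟨hi, hj, hm⟩ := hc
    rw [abs_lt] at hi hj hm
    apply hnb
    simp only [blockFin, Finset.mem_erase, Finset.mem_product, Finset.mem_Icc]
    exact ⟨hn0, ⟨by omega, by omega⟩, ⟨by omega, by omega⟩, by omega, by omega⟩
  have hY : Y₀ (i, j, m) ≠ 0 := Y₀_ne_zero hn0
  rw [hx, if_neg hY, Hess₀_ex₁_eq hY]
  have hq4 : 4 ≤ ‖Y₀ (i, j, m)‖ ^ 2 := (slab_bounds i j m).2.2.2 hout
  have hpq : (Y₀ (i, j, m) 0) ^ 2 ≤ ‖Y₀ (i, j, m)‖ ^ 2 := by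
    rw [EuclideanSpace.norm_sq_eq, Fin.sum_univ_three]
    simp only [Real.norm_eq_abs, sq_abs]
    nlinarith [sq_nonneg (Y₀ (i, j, m) 1), sq_nonneg (Y₀ (i, j, m) 2)]
  exact (TQ_le (sq_nonneg _) hpq hq4).trans (inv_pow_four_le_slabs hout)

/-- Products of three absolutely summable weights are summable over `ℤ³` with the product sum.
[folklore] -/
theorem hasSum_mul3 {f g k : ℤ → ℝ} (hf : Summable fun n => ‖f n‖) (hg : Summable fun n => ‖g n‖)
    (hk : Summable fun n => ‖k n‖) :
    HasSum (fun n : ℤ × ℤ × ℤ => f n.1 * (g n.2.1 * k n.2.2))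
      ((∑' n, f n) * ((∑' n, g n) * ∑' n, k n)) := by
  have hgk : Summable fun p : ℤ × ℤ => ‖g p.1 * k p.2‖ := hg.mul_norm hk
  rw [tsum_mul_tsum_of_summable_norm hg hk, tsum_mul_tsum_of_summable_norm hf hgk]
  exact (summable_mul_of_summable_norm hf hgk).hasSum

/-- The majorant is summable with an explicit sum. [folklore] -/
theorem hasSum_Bmaj3 : HasSum Bmaj3
    (cA ^ 2 * ((∑' n, t4 n) * ((∑' n, w2 cA n) * ∑' n, w2 cH n)) +
      cA ^ 2 * ((∑' n, w2 cA n) * ((∑' n, t4 n) * ∑' n, w2 cH n)) +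
      cH ^ 2 * ((∑' n, w2 cA n) * ((∑' n, w2 cA n) * ∑' n, t4 n))) := by
  have hA := summable_norm_w2 cA
  have hH := summable_norm_w2 cH
  exact (((hasSum_mul3 summable_norm_t4 hA hH).mul_left _).add
    ((hasSum_mul3 hA summable_norm_t4 hH).mul_left _)).add
    ((hasSum_mul3 hA hA summable_norm_t4).mul_left _)

/-- **The far field is at most `21`.** [folklore] -/
theorem tsum_Bmaj3_le : ∑' n, Bmaj3 n ≤ 21 := by
  rw [hasSum_Bmaj3.tsum_eq]
  have ht := tsum_t4_le
  have ht0 : 0 ≤ ∑' n, t4 n := tsum_nonneg t4_nonneg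
  have hwA := tsum_w2_le cA_pos.1.le
  have hwH := tsum_w2_le cA_pos.2.le
  have hwA0 : 0 ≤ ∑' n, w2 cA n := tsum_nonneg (w2_nonneg cA_pos.1.le)
  have hwH0 : 0 ≤ ∑' n, w2 cH n := tsum_nonneg (w2_nonneg cA_pos.2.le)
  have hcA : cA ≤ 151 / 100 := by unfold cA a₀; norm_num
  have hcH : cH ≤ 187 / 100 := by unfold cH h₀ a₀; norm_num
  have hcA0 := cA_pos.1.le
  have hcH0 := cA_pos.2.le
  set T := ∑' n, t4 n
  set WA := ∑' n, w2 cA n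
  set WH := ∑' n, w2 cH n
  have hWA : WA ≤ 6 := by nlinarith
  have hWH : WH ≤ 72 / 10 := by nlinarith
  have h1 : cA ^ 2 * (T * (WA * WH)) ≤ (151 / 100) ^ 2 * (63 / 1000 * (6 * (72 / 10))) := by
    gcongr
  have h2 : cA ^ 2 * (WA * (T * WH)) ≤ (151 / 100) ^ 2 * (6 * (63 / 1000 * (72 / 10))) := by
    gcongr
  have h3 : cH ^ 2 * (WA * (WA * T)) ≤ (187 / 100) ^ 2 * (6 * (6 * (63 / 1000))) := by
    gcongr
  linarith

/-! ### Summability of the row function and the sign of the second variation -/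

/-- The full row function is absolutely summable over the labels (`|e₁ᵀK(y)e₁| ≤ 904‖y‖⁻⁸` on the
lattice). [folklore] -/
theorem summable_hx_Y₀ : Summable fun n : ℤ × ℤ × ℤ => hx (Y₀ n) := by
  set L := shLat a₀_ne_zero'.1 a₀_ne_zero'.2
  let φ : ℤ × ℤ × ℤ → L := fun n => ⟨Y₀ n, Y₀_mem n⟩
  have hφ : Function.Injective φ := fun n n' h =>
    Y₀_injective (congrArg (fun y : L => (y : E3)) h)
  have h8 := ZLattice.summable_norm_sub_inv_pow L 8 (by rw [finrank_shLat]; norm_num) 0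
  have h8' := (h8.comp_injective hφ).mul_left 904
  refine Summable.of_norm_bounded h8' fun n => ?_
  rw [Real.norm_eq_abs]
  simp only [Function.comp, φ, sub_zero]
  unfold hx
  split_ifs with h0
  · rw [abs_zero]; positivity
  · exact abs_Hess₀_le_inv_pow (half_le_norm_Y₀ h0) norm_ex₁

/-- **The second variation of `e₁·𝟙_{0}` on the AAA lattice is negative:**
`Σ'_n e₁ᵀK(Y₀ n)e₁ < −75.8 + 21 < 0`. [folklore] -/
theorem tsum_hx_Y₀_neg : ∑' n : ℤ × ℤ × ℤ, hx (Y₀ n) < 0 := by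
  obtain ⟨S, hS, hSlt⟩ := hasSum_Tnear
  have hfar : Summable Tfar := by
    have := summable_hx_Y₀.sub hS.summable
    refine this.congr fun n => ?_
    rw [hx_eq_add]; ring
  have hsplit : ∑' n : ℤ × ℤ × ℤ, hx (Y₀ n) = S + ∑' n, Tfar n := by
    rw [← hS.tsum_eq, ← hS.summable.tsum_add hfar]
    exact tsum_congr hx_eq_add
  have hle : ∑' n, Tfar n ≤ ∑' n, Bmaj3 n :=
    Summable.tsum_le_tsum Tfar_le_Bmaj3 hfar hasSum_Bmaj3.summable
  linarith [tsum_Bmaj3_le]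

/-- Reindexing the lattice row sum by labels. [folklore] -/
theorem tsum_Hrow_shLat_eq :
    ∑' y : shLat a₀_ne_zero'.1 a₀_ne_zero'.2, Hrow (shLat a₀_ne_zero'.1 a₀_ne_zero'.2) ex₁ y =
      ∑' n : ℤ × ℤ × ℤ, hx (Y₀ n) := by
  set L := shLat a₀_ne_zero'.1 a₀_ne_zero'.2
  let φ : ℤ × ℤ × ℤ → L := fun n => ⟨Y₀ n, Y₀_mem n⟩
  have hφ : Function.Injective φ := fun n n' h =>
    Y₀_injective (congrArg (fun y : L => (y : E3)) h)
  have hsupp : Function.support (Hrow L ex₁) ⊆ Set.range φ := by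
    intro y _
    obtain ⟨n, hn⟩ := exists_Y₀_eq y.2
    exact ⟨n, Subtype.ext hn⟩
  rw [← hφ.tsum_eq hsupp]
  refine tsum_congr fun n => ?_
  simp only [Hrow, hx, φ, Submodule.mk_eq_zero]

/-- **The Hägg condition is load-bearing.**  On the window `47/50 ≤ a ∧ a ≤ 1 ∧ HeightBox a z`
with NO condition on the word `s` (the crux's `Box` with `IsHaggSeq s` deleted), uniform polytype
stability FAILS: the zero word `s ≡ 0` (`haggLabel ≡ 0`, every layer in registry `A`, i.e. the
simple-hexagonal AAA stacking) at `a = 47/50` and uniform heights `h₀·m`, `h₀ = 39a/50 = 0.7332`,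
is in the window and force balanced (a Bravais lattice, part I), but its VERTICAL bonds have
length `h₀ < 1` and are compressed: for `u = e₁·𝟙_{0}`, `½·hessForm = Σ_{y≠0} e₁ᵀK(y)e₁ < 0`
(near field `|n|_∞ ≤ 2` evaluated exactly over `ℚ` by the kernel: `−75.86`, of which the two
vertical bonds give `2V′(h₀)/h₀ = −130.19` and the six in-plane bonds `+56.08`; far field
`≤ q⁻⁴ ≤` three slab majorants summed with `ζ(2)`, `ζ(4)`, `π < 3.15`: `≤ 21`), while
`κ·nnForm ≥ 0`. [folklore] -/
theorem uniformPolytypeStability_false_without_hagg :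
    ¬ UniformPolytypeStabilityOn fun a _ z => 47 / 50 ≤ a ∧ a ≤ 1 ∧ HeightBox a z := by
  rintro ⟨κ, hκ, h⟩
  set L := shLat a₀_ne_zero'.1 a₀_ne_zero'.2
  have hS : Sites a₀ 0 (zU h₀) = (L : Set E3) := sites_zero_zU a₀_ne_zero'.1 a₀_ne_zero'.2
  have hW : 47 / 50 ≤ a₀ ∧ a₀ ≤ 1 ∧ HeightBox a₀ (zU h₀) := by
    refine ⟨by unfold a₀; norm_num, by unfold a₀; norm_num, heightBox_zU ?_ ?_⟩
    · unfold h₀; linarith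
    · unfold h₀ a₀; norm_num
  have hF : ForceBalanced a₀ 0 (zU h₀) := forceBalanced_of_sites_eq L (finrank_shLat _ _) hS
  have hsupp : Function.support (uS ex₁) ⊆ Sites a₀ 0 (zU h₀) :=
    (support_uS ex₁).trans (by
      intro p hp
      rw [Set.mem_singleton_iff] at hp
      subst hp
      rw [hS]
      exact L.zero_mem)
  have hmin : ∀ y ∈ L, y ≠ 0 → (1 / 2 : ℝ) ≤ ‖y‖ := by
    intro y hy hy0
    obtain ⟨n, rfl⟩ := exists_Y₀_eq hy
    exact half_le_norm_Y₀ hy0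
  have key := h a₀ 0 (zU h₀) hW hF (uS ex₁) (finite_support_uS ex₁) hsupp
  rw [hessForm_single L (finrank_shLat _ _) hS hmin norm_ex₁, tsum_Hrow_shLat_eq] at key
  have hnn := mul_nonneg hκ.le (nnForm_nonneg a₀ 0 (zU h₀) (uS ex₁))
  linarith [tsum_hx_Y₀_neg]

end Hagg

/-! ## Part V″ — The LOWER height bound is load-bearing (squashed fcc lattice, PROVED)

Byte-identical (up to the namespace) to the disprover's `Negative/HeightLower.lean` (proposable once
`WithoutHagg.lean` and `HeightUpper.lean` are in the tree). -/

section HeightLowerPart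

open Summit.AtomisticToContinuum.Crystallization.Theorems.UniformPolytypeStabilityNegative Real

section HeightLower

/-! ## §9 The squashed fcc lattice: the LOWER height bound `39a/50 ≤ z(m+1) − z(m)` is load-bearing -/

/-! ### Row formula without a separation hypothesis -/

/-- **Row structure of the second variation of `ξ·𝟙_{0}` on a Bravais site set, summable
version:** as `hessForm_single`, with the absolute summability of the row supplied directly
instead of through the separation `‖y‖ ≥ 1/2` (needed for squashed lattices). [folklore] -/
theorem hessForm_single_of_summable {a : ℝ} {s : ℤ → ℤ} {z : ℤ → ℝ} (L : Submodule ℤ E3)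
    (hS : Sites a s z = (L : Set E3)) {ξ : E3} (hsum : Summable (Hrow L ξ)) :
    hessForm a s z (uS ξ) = 2 * ∑' y : L, Hrow L ξ y := by
  unfold hessForm
  rw [tsum_tsum_sites_eq L hS (fun p q => if p ≠ q then Hess₀ (p - q) (uS ξ p - uS ξ q) else 0)]
  have hrow : ∀ x : L, (∑' y : L, if (x : E3) ≠ y then Hess₀ ((x : E3) - y) (uS ξ x - uS ξ y) else 0) =
      Hrow L ξ x + if x = 0 then ∑' y, Hrow L ξ y else 0 := by
    intro x
    by_cases hx0 : x = 0
    · subst hx0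
      rw [if_pos rfl]
      have h0 : Hrow L ξ 0 = 0 := by simp [Hrow]
      rw [h0, zero_add]
      refine tsum_congr fun y => ?_
      by_cases hy : y = 0
      · subst hy; simp [Hrow]
      · have hy' : (y : E3) ≠ 0 := fun h => hy (Submodule.coe_eq_zero.1 h)
        rw [Submodule.coe_zero, if_pos hy'.symm, uS_zero, uS_of_ne ξ hy', sub_zero, zero_sub,
          Hess₀_neg_left]
        simp [Hrow, hy]
    · rw [if_neg hx0, add_zero]
      have hx' : (x : E3) ≠ 0 := fun h => hx0 (Submodule.coe_eq_zero.1 h)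
      have hfun : (fun y : L => if (x : E3) ≠ y then Hess₀ ((x : E3) - y) (uS ξ x - uS ξ y) else 0) =
          fun y => if y = 0 then Hrow L ξ x else 0 := by
        funext y
        by_cases hy : y = 0
        · subst hy
          rw [if_pos rfl, Submodule.coe_zero, if_pos hx', uS_of_ne ξ hx', uS_zero, sub_zero, zero_sub,
            Hess₀_neg_right]
          simp [Hrow, hx0]
        · have hy' : (y : E3) ≠ 0 := fun h => hy (Submodule.coe_eq_zero.1 h)
          by_cases hxy : (x : E3) = y
          · rw [if_neg (not_not.2 hxy), if_neg hy]
          · rw [if_pos hxy, if_neg hy, uS_of_ne ξ hx', uS_of_ne ξ hy', sub_zero, Hess₀_zero_right]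
      rw [hfun, tsum_ite_eq]
  rw [show (fun x : L => ∑' y : L, if (x : E3) ≠ y then Hess₀ ((x : E3) - y) (uS ξ x - uS ξ y) else 0) =
      fun x => Hrow L ξ x + if x = 0 then ∑' y, Hrow L ξ y else 0 from funext hrow]
  rw [hsum.tsum_add (hasSum_ite_eq (0 : L) _).summable, tsum_ite_eq]
  ring

/-! ### The squashed fcc lattice `a = 47/50`, `h = 1/10`, in sheared labels -/

/-- The squashed layer spacing `h = 1/10` (far below the box `h ≥ 39a/50`). [folklore] -/
def hSq : ℝ := 1 / 10

/-- `hSq ≠ 0` and `hSq > 0`. [folklore] -/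
theorem hSq_ne_zero_pos : hSq ≠ 0 ∧ 0 < hSq := by unfold hSq; norm_num

/-- Registry period bookkeeping: `k(m) = ⌊(m+1)/3⌋`. [folklore] -/
def kOf (m : ℤ) : ℤ := (m + 1) / 3

/-- The centred registry letter `l(m) = m − 3k(m) ∈ {−1, 0, 1}` of layer `m` of the fcc word. [folklore] -/
def lOf (m : ℤ) : ℤ := m - 3 * kOf m

/-- `−1 ≤ l(m) ≤ 1`. [folklore] -/
theorem lOf_abs_le (m : ℤ) : -1 ≤ lOf m ∧ lOf m ≤ 1 := by
  unfold lOf kOf; omega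

/-- The shear `(i, j, m) ↦ (i − k(m), j − k(m), m)` of the label lattice `ℤ³` (an equivalence):
in sheared labels the fcc vector is `i u + j v + l(m) w + m h e₃` with a BOUNDED registry
offset `l(m) w`. [folklore] -/
def shear : ℤ × ℤ × ℤ ≃ ℤ × ℤ × ℤ where
  toFun n := (n.1 - kOf n.2.2, n.2.1 - kOf n.2.2, n.2.2)
  invFun n := (n.1 + kOf n.2.2, n.2.1 + kOf n.2.2, n.2.2)
  left_inv n := by simp
  right_inv n := by simp

/-- Sheared labels of the squashed fcc lattice `fccLat a₀ hSq`. [folklore] -/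
def YL (n : ℤ × ℤ × ℤ) : E3 := Y hSq (shear n)

/-- First coordinate of `YL`. [folklore] -/
theorem YL_apply_zero (n : ℤ × ℤ × ℤ) : YL n 0 = a₀ * (n.1 + n.2.1 / 2 + lOf n.2.2 / 2) := by
  simp only [YL, shear, Equiv.coe_fn_mk, Y_apply_zero, lOf]
  push_cast
  ring

/-- Second coordinate of `YL`. [folklore] -/
theorem YL_apply_one (n : ℤ × ℤ × ℤ) : YL n 1 = a₀ * √3 / 2 * (n.2.1 + lOf n.2.2 / 3) := by
  simp only [YL, shear, Equiv.coe_fn_mk, Y_apply_one, lOf]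
  push_cast
  ring

/-- Third coordinate of `YL`. [folklore] -/
theorem YL_apply_two (n : ℤ × ℤ × ℤ) : YL n 2 = n.2.2 * hSq := by
  simp only [YL, shear, Equiv.coe_fn_mk, Y_apply_two]

/-- `YL 0 = 0`. [folklore] -/
theorem YL_zero : YL 0 = 0 := by
  have hk : kOf 0 = 0 := by decide
  show Y hSq ((0 : ℤ × ℤ × ℤ).1 - kOf (0 : ℤ × ℤ × ℤ).2.2, (0 : ℤ × ℤ × ℤ).2.1 - kOf (0 : ℤ × ℤ × ℤ).2.2,
    (0 : ℤ × ℤ × ℤ).2.2) = 0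
  simp only [Prod.fst_zero, Prod.snd_zero, hk, sub_zero, Prod.mk_zero_zero]
  exact Y_zero hSq

/-- `YL n` is a vector of the squashed fcc lattice. [folklore] -/
theorem YL_mem (n : ℤ × ℤ × ℤ) : YL n ∈ fccLat a₀_ne_zero hSq_ne_zero_pos.1 :=
  Y_mem hSq_ne_zero_pos.1 _

/-- Every vector of the squashed fcc lattice has a sheared label. [folklore] -/
theorem exists_YL_eq {g : E3} (hg : g ∈ fccLat a₀_ne_zero hSq_ne_zero_pos.1) : ∃ n, YL n = g := by
  obtain ⟨n, hn⟩ := exists_Y_eq hSq_ne_zero_pos.1 hg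
  exact ⟨shear.symm n, by rw [YL, Equiv.apply_symm_apply, hn]⟩

/-- Sheared labels are unique. [folklore] -/
theorem YL_injective : Function.Injective YL :=
  (Y_injective hSq_ne_zero_pos.1).comp shear.injective

/-- Labels off the origin are nonzero vectors. [folklore] -/
theorem YL_ne_zero {n : ℤ × ℤ × ℤ} (hn : n ≠ 0) : YL n ≠ 0 := fun h =>
  hn (YL_injective (h.trans YL_zero.symm))

/-- `‖YL(i,j,m)‖²` in coordinates. [folklore] -/
theorem norm_sq_YL (n : ℤ × ℤ × ℤ) :
    ‖YL n‖ ^ 2 = (a₀ * (n.1 + n.2.1 / 2 + lOf n.2.2 / 2)) ^ 2 +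
      (a₀ * √3 / 2 * (n.2.1 + lOf n.2.2 / 3)) ^ 2 + (n.2.2 * hSq) ^ 2 := by
  rw [EuclideanSpace.norm_sq_eq, Fin.sum_univ_three, YL_apply_zero, YL_apply_one, YL_apply_two]
  simp only [Real.norm_eq_abs, sq_abs]

/-! ### Exact near field over `ℚ` (kernel evaluation) -/

/-- `x₁²` of a sheared label over `ℚ`. [folklore] -/
def pL (n : ℤ × ℤ × ℤ) : ℚ := a2q * ((n.1 : ℚ) + n.2.1 / 2 + (lOf n.2.2 : ℚ) / 2) ^ 2

/-- `‖YL n‖²` over `ℚ`. [folklore] -/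
def qL (n : ℤ × ℤ × ℤ) : ℚ :=
  a2q * (((n.1 : ℚ) + n.2.1 / 2 + (lOf n.2.2 : ℚ) / 2) ^ 2 +
      3 / 4 * ((n.2.1 : ℚ) + (lOf n.2.2 : ℚ) / 3) ^ 2) + (n.2.2 : ℚ) ^ 2 / 100

/-- The near block `|i|,|j| ≤ 2`, `|m| ≤ 9` (sheared labels) minus the origin: 474 vectors,
among them the two collinear compressed bonds `±3h e₃ = YL(0,0,±3)`. [folklore] -/
def blockL : Finset (ℤ × ℤ × ℤ) :=
  (Finset.Icc (-2 : ℤ) 2 ×ˢ Finset.Icc (-2 : ℤ) 2 ×ˢ Finset.Icc (-9 : ℤ) 9).erase 0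

/-- **Exact near field of the squashed fcc lattice** (kernel evaluation over `ℚ`):
`Σ_{block} T = −41 575 290.9… < −4·10⁷` (the two bonds `±3h e₃`, `|3h| = 0.3`, give
`2(V′(r)/r)/12`-units `2(−q⁻⁷ + q⁻⁴) = −4.18·10⁷` at `q = 9/100`; everything else in the block is
`+2.2·10⁵`). [folklore] -/
theorem near_sum_lt_sq : (∑ n ∈ blockL, TQq (pL n) (qL n)) < -40000000 := by
  decide +kernel

/-- `pL` is the squared first coordinate. [folklore] -/
theorem cast_pL (n : ℤ × ℤ × ℤ) : ((pL n : ℚ) : ℝ) = (YL n 0) ^ 2 := by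
  rw [YL_apply_zero]; unfold pL a2q a₀; push_cast; ring

/-- `qL` is the squared norm. [folklore] -/
theorem cast_qL (n : ℤ × ℤ × ℤ) : ((qL n : ℚ) : ℝ) = ‖YL n‖ ^ 2 := by
  have h3 : (√3 : ℝ) ^ 2 = 3 := Real.sq_sqrt (by norm_num)
  rw [norm_sq_YL]; unfold qL a2q hSq a₀; push_cast
  linear_combination (-((47 / 50 : ℝ) ^ 2 * ((n.2.1 : ℝ) + (lOf n.2.2 : ℝ) / 3) ^ 2 / 4)) * h3

/-- On a label `n ≠ 0` the row function is the cast of the rational value. [folklore] -/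
theorem hx_YL {n : ℤ × ℤ × ℤ} (hn : n ≠ 0) : hx (YL n) = ((TQq (pL n) (qL n) : ℚ) : ℝ) := by
  rw [cast_TQq, cast_pL, cast_qL, hx, if_neg (YL_ne_zero hn), Hess₀_ex₁_eq (YL_ne_zero hn)]

/-- The near part of the row function. [folklore] -/
def TnearL (n : ℤ × ℤ × ℤ) : ℝ := if n ∈ blockL then hx (YL n) else 0

/-- The far part of the row function. [folklore] -/
def TfarL (n : ℤ × ℤ × ℤ) : ℝ := if n = 0 ∨ n ∈ blockL then 0 else hx (YL n)

/-- Row = near + far. [folklore] -/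
theorem hx_eq_addL (n : ℤ × ℤ × ℤ) : hx (YL n) = TnearL n + TfarL n := by
  unfold TnearL TfarL
  by_cases h0 : n = 0
  · subst h0; simp [hx, YL_zero, blockL]
  · by_cases hb : n ∈ blockL <;> simp [hb, h0]

/-- The near part has `HasSum < −4·10⁷`. [folklore] -/
theorem hasSum_TnearL : ∃ S : ℝ, HasSum TnearL S ∧ S < -40000000 := by
  refine ⟨∑ n ∈ blockL, TnearL n, hasSum_sum_of_ne_finset_zero fun n hn => if_neg hn, ?_⟩
  have he : ∑ n ∈ blockL, TnearL n = ((∑ n ∈ blockL, TQq (pL n) (qL n) : ℚ) : ℝ) := by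
    rw [Rat.cast_sum]
    refine Finset.sum_congr rfl fun n hn => ?_
    have hn0 : n ≠ 0 := (Finset.mem_erase.1 hn).1
    rw [TnearL, if_pos hn, hx_YL hn0]
  rw [he]
  exact_mod_cast near_sum_lt_sq

/-! ### The far field: crude two-sided bound `|T| ≤ 8q⁻⁴` (`q ≥ 1`) and three slab majorants -/

/-- For `0 ≤ p ≤ q` and `q ≥ 1`: `−8q⁻⁴ ≤ T(p,q) ≤ 7q⁻⁴`. [folklore] -/
theorem TQ_abs_bounds {p q : ℝ} (hp0 : 0 ≤ p) (hpq : p ≤ q) (h1 : 1 ≤ q) :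
    TQ p q ≤ 7 * (q⁻¹) ^ 4 ∧ -(8 * (q⁻¹) ^ 4) ≤ TQ p q := by
  have hq : 0 < q := by linarith
  have hr0 : 0 < q⁻¹ := inv_pos.2 hq
  have hr1 : q⁻¹ ≤ 1 := inv_le_one_of_one_le₀ h1
  have ht0 : 0 ≤ p / q := div_nonneg hp0 hq.le
  have ht1 : p / q ≤ 1 := (div_le_one hq).2 hpq
  have hr4 : 0 ≤ (q⁻¹) ^ 4 := by positivity
  have hr7 : 0 ≤ (q⁻¹) ^ 7 := by positivity
  have hr74 : (q⁻¹) ^ 7 ≤ (q⁻¹) ^ 4 := pow_le_pow_of_le_one hr0.le hr1 (by norm_num)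
  have hA : p / q * (q⁻¹) ^ 7 ≤ p / q * (q⁻¹) ^ 4 := mul_le_mul_of_nonneg_left hr74 ht0
  have hB : 0 ≤ p / q * (q⁻¹) ^ 7 := mul_nonneg ht0 hr7
  have hC : p / q * (q⁻¹) ^ 4 ≤ (q⁻¹) ^ 4 := mul_le_of_le_one_left hr4 ht1
  have e : TQ p q = 14 * (p / q * (q⁻¹) ^ 7) - 8 * (p / q * (q⁻¹) ^ 4) - (q⁻¹) ^ 7 + (q⁻¹) ^ 4 := by
    unfold TQ; ring
  rw [e]
  constructor <;> linarith

/-- `4i² ≤ (3i + l)²` for integers `i` and `|l| ≤ 1`. [folklore] -/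
theorem four_sq_le_sq_three_add (i l : ℤ) (hl : -1 ≤ l ∧ l ≤ 1) : 4 * i ^ 2 ≤ (3 * i + l) ^ 2 := by
  rcases (show l = -1 ∨ l = 0 ∨ l = 1 by omega) with rfl | rfl | rfl
  · rcases le_or_gt 1 i with hi | hi
    · nlinarith
    · have hi' : i ≤ 0 := by omega
      nlinarith
  · nlinarith
  · rcases le_or_gt 0 i with hi | hi
    · nlinarith
    · have hi' : i ≤ -1 := by omega
      nlinarith

/-- `|n| ≥ 10 ⟹ n² ≥ 100` (cast to `ℝ`). [folklore] -/
theorem hundred_le_sq_of_abs {n : ℤ} (hn : 10 ≤ |n|) : (100 : ℝ) ≤ (n : ℝ) ^ 2 := by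
  have h : (10 : ℤ) * 10 ≤ |n| * |n| := mul_le_mul hn hn (by norm_num) (abs_nonneg n)
  rw [abs_mul_abs_self] at h
  have h' : (100 : ℤ) ≤ n ^ 2 := by rw [sq]; linarith
  exact_mod_cast h'

/-- Slab lower bounds for `q = ‖YL(i,j,m)‖²` in sheared labels: `q ≥ (a₀²/3)i²`, `(a₀²/3)j²`,
`m²/100`, `0 ≤ x₁² ≤ q`, and `q ≥ 1` outside the block. [folklore] -/
theorem slabL_bounds (i j m : ℤ) :
    a₀ ^ 2 / 3 * (i : ℝ) ^ 2 ≤ ‖YL (i, j, m)‖ ^ 2 ∧ a₀ ^ 2 / 3 * (j : ℝ) ^ 2 ≤ ‖YL (i, j, m)‖ ^ 2 ∧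
      (100 : ℝ)⁻¹ * (m : ℝ) ^ 2 ≤ ‖YL (i, j, m)‖ ^ 2 ∧
      (0 ≤ (YL (i, j, m) 0) ^ 2 ∧ (YL (i, j, m) 0) ^ 2 ≤ ‖YL (i, j, m)‖ ^ 2) ∧
      (3 ≤ |i| ∨ 3 ≤ |j| ∨ 10 ≤ |m| → 1 ≤ ‖YL (i, j, m)‖ ^ 2) := by
  have h3 : (√3 : ℝ) ^ 2 = 3 := Real.sq_sqrt (by norm_num)
  have hl := lOf_abs_le m
  have hli : (4 : ℝ) * (i : ℝ) ^ 2 ≤ (3 * i + lOf m) ^ 2 := by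
    exact_mod_cast four_sq_le_sq_three_add i (lOf m) hl
  have hlj : (4 : ℝ) * (j : ℝ) ^ 2 ≤ (3 * j + lOf m) ^ 2 := by
    exact_mod_cast four_sq_le_sq_three_add j (lOf m) hl
  have hx0 : (YL (i, j, m) 0) ^ 2 = a₀ ^ 2 * ((i : ℝ) + j / 2 + lOf m / 2) ^ 2 := by
    rw [YL_apply_zero]; ring
  have hq : ‖YL (i, j, m)‖ ^ 2 = a₀ ^ 2 * ((i : ℝ) + j / 2 + lOf m / 2) ^ 2 +
      3 * a₀ ^ 2 / 4 * ((j : ℝ) + lOf m / 3) ^ 2 + (m : ℝ) ^ 2 * hSq ^ 2 := by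
    rw [norm_sq_YL]; dsimp only
    linear_combination (a₀ ^ 2 * ((j : ℝ) + lOf m / 3) ^ 2 / 4) * h3
  have hA2 : a₀ ^ 2 = 2209 / 2500 := by unfold a₀; norm_num
  have hH2 : hSq ^ 2 = 1 / 100 := by unfold hSq; norm_num
  rw [hx0, hq, hA2, hH2]
  have k1 : 0 ≤ ((i : ℝ) + j / 2 + lOf m / 2) ^ 2 := sq_nonneg _
  have k2 : 0 ≤ ((j : ℝ) + lOf m / 3) ^ 2 := sq_nonneg _
  have k3 : ((i : ℝ) + j / 2 + lOf m / 2) ^ 2 + 3 / 4 * ((j : ℝ) + lOf m / 3) ^ 2 =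
      3 / 4 * ((i : ℝ) + lOf m / 3) ^ 2 + (((i : ℝ) + lOf m / 3) / 2 + ((j : ℝ) + lOf m / 3)) ^ 2 := by
    ring
  have k4 : 0 ≤ (((i : ℝ) + lOf m / 3) / 2 + ((j : ℝ) + lOf m / 3)) ^ 2 := sq_nonneg _
  have m1 : (4 : ℝ) * (i : ℝ) ^ 2 ≤ 9 * ((i : ℝ) + lOf m / 3) ^ 2 := by
    have e : (9 : ℝ) * ((i : ℝ) + lOf m / 3) ^ 2 = (3 * i + lOf m) ^ 2 := by ring
    rw [e]; exact hli
  have m2 : (4 : ℝ) * (j : ℝ) ^ 2 ≤ 9 * ((j : ℝ) + lOf m / 3) ^ 2 := by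
    have e : (9 : ℝ) * ((j : ℝ) + lOf m / 3) ^ 2 = (3 * j + lOf m) ^ 2 := by ring
    rw [e]; exact hlj
  have hm2 : (0 : ℝ) ≤ (m : ℝ) ^ 2 := sq_nonneg _
  refine ⟨by linarith, by linarith, by linarith, ⟨by positivity, by linarith⟩, ?_⟩
  have nine : ∀ {n : ℤ}, 3 ≤ |n| → (9 : ℝ) ≤ (n : ℝ) ^ 2 := fun {n} hn => by
    have h : (3 : ℤ) * 3 ≤ |n| * |n| := mul_le_mul hn hn (by norm_num) (abs_nonneg n)
    rw [abs_mul_abs_self] at h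
    have h' : (9 : ℤ) ≤ n ^ 2 := by rw [sq]; linarith
    exact_mod_cast h'
  rintro (hi | hj | hm)
  · have := nine hi; linarith
  · have := nine hj; linarith
  · have := hundred_le_sq_of_abs hm; linarith

/-- `q⁻¹ ≤ w_c(n)` when `q ≥ 1` and `q ≥ n²/c` (`c > 0`). [folklore] -/
theorem inv_le_w2_of_le {q c : ℝ} {n : ℤ} (hc : 0 < c) (hq1 : 1 ≤ q) (hqn : c⁻¹ * (n : ℝ) ^ 2 ≤ q) :
    q⁻¹ ≤ w2 c n := by
  unfold w2
  split_ifs with hn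
  · exact inv_le_one_of_one_le₀ hq1
  · have hn2 : (0 : ℝ) < (n : ℝ) ^ 2 := by positivity
    rw [show c * ((n : ℝ) ^ 2)⁻¹ = (c⁻¹ * (n : ℝ) ^ 2)⁻¹ by rw [mul_inv, inv_inv]]
    exact inv_anti₀ (by positivity) hqn

/-- In-plane weight constant of the sheared labels, `3/a₀²`. [folklore] -/
def cL : ℝ := 3 / a₀ ^ 2

/-- `cL > 0` and `cL⁻¹ = a₀²/3`. [folklore] -/
theorem cL_pos_inv : 0 < cL ∧ cL⁻¹ = a₀ ^ 2 / 3 := by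
  refine ⟨by unfold cL a₀; norm_num, by unfold cL; rw [inv_div]⟩

/-- The far-field majorant of the squashed lattice: `8·(i-slab + j-slab + m-slab)`. [folklore] -/
def BL (n : ℤ × ℤ × ℤ) : ℝ :=
  8 * (cL ^ 2 * (t4 n.1 * (w2 cL n.2.1 * w2 100 n.2.2)) +
    cL ^ 2 * (w2 cL n.1 * (t4 n.2.1 * w2 100 n.2.2)) +
    100 ^ 2 * (w2 cL n.1 * (w2 cL n.2.1 * t4 n.2.2)))

/-- The three slab terms are `≥ 0`. [folklore] -/
theorem BL_parts_nonneg (n : ℤ × ℤ × ℤ) :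
    0 ≤ cL ^ 2 * (t4 n.1 * (w2 cL n.2.1 * w2 100 n.2.2)) ∧
      0 ≤ cL ^ 2 * (w2 cL n.1 * (t4 n.2.1 * w2 100 n.2.2)) ∧
        0 ≤ (100 : ℝ) ^ 2 * (w2 cL n.1 * (w2 cL n.2.1 * t4 n.2.2)) := by
  have hA := w2_nonneg cL_pos_inv.1.le
  have hH := w2_nonneg (show (0 : ℝ) ≤ 100 by norm_num)
  exact ⟨by have := t4_nonneg n.1; have := hA n.2.1; have := hH n.2.2; positivity,
    by have := t4_nonneg n.2.1; have := hA n.1; have := hH n.2.2; positivity,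
    by have := t4_nonneg n.2.2; have := hA n.1; have := hA n.2.1; positivity⟩

/-- Outside the block `q⁻⁴` is dominated by the three slab terms. [folklore] -/
theorem inv_pow_four_le_slabsL {i j m : ℤ} (hout : 3 ≤ |i| ∨ 3 ≤ |j| ∨ 10 ≤ |m|) :
    ((‖YL (i, j, m)‖ ^ 2)⁻¹) ^ 4 ≤ cL ^ 2 * (t4 i * (w2 cL j * w2 100 m)) +
      cL ^ 2 * (w2 cL i * (t4 j * w2 100 m)) + 100 ^ 2 * (w2 cL i * (w2 cL j * t4 m)) := by
  obtain ⟨hB1, hB2, hB3⟩ := BL_parts_nonneg (i, j, m)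
  dsimp only at hB1 hB2 hB3
  obtain ⟨hqi, hqj, hqm, -, h1⟩ := slabL_bounds i j m
  have hq1 := h1 hout
  set q : ℝ := ‖YL (i, j, m)‖ ^ 2
  have hi0 : 0 ≤ q⁻¹ := inv_nonneg.2 (by linarith)
  have hcL := cL_pos_inv
  have hwA := w2_nonneg hcL.1.le
  have h100 : (0 : ℝ) < 100 := by norm_num
  have e4 : (q⁻¹) ^ 4 = (q⁻¹) ^ 2 * (q⁻¹ * q⁻¹) := by ring
  rw [e4]
  have hqi' : cL⁻¹ * (i : ℝ) ^ 2 ≤ q := by rw [hcL.2]; exact hqi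
  have hqj' : cL⁻¹ * (j : ℝ) ^ 2 ≤ q := by rw [hcL.2]; exact hqj
  rcases hout with hi | hj | hm
  · have h1 : (q⁻¹) ^ 2 ≤ cL ^ 2 * t4 i := inv_sq_le_t4 hcL.1 hi hqi'
    have h2 : q⁻¹ * q⁻¹ ≤ w2 cL j * w2 100 m :=
      mul_le_mul (inv_le_w2_of_le hcL.1 hq1 hqj') (inv_le_w2_of_le h100 hq1 hqm) hi0 (hwA j)
    have h3 := mul_le_mul h1 h2 (by positivity) (by have := t4_nonneg i; positivity)
    calc (q⁻¹) ^ 2 * (q⁻¹ * q⁻¹) ≤ cL ^ 2 * t4 i * (w2 cL j * w2 100 m) := h3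
      _ = cL ^ 2 * (t4 i * (w2 cL j * w2 100 m)) := by ring
      _ ≤ _ := by linarith
  · have h1 : (q⁻¹) ^ 2 ≤ cL ^ 2 * t4 j := inv_sq_le_t4 hcL.1 hj hqj'
    have h2 : q⁻¹ * q⁻¹ ≤ w2 cL i * w2 100 m :=
      mul_le_mul (inv_le_w2_of_le hcL.1 hq1 hqi') (inv_le_w2_of_le h100 hq1 hqm) hi0 (hwA i)
    have h3 := mul_le_mul h1 h2 (by positivity) (by have := t4_nonneg j; positivity)
    calc (q⁻¹) ^ 2 * (q⁻¹ * q⁻¹) ≤ cL ^ 2 * t4 j * (w2 cL i * w2 100 m) := h3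
      _ = cL ^ 2 * (w2 cL i * (t4 j * w2 100 m)) := by ring
      _ ≤ _ := by linarith
  · have hm3 : 3 ≤ |m| := le_trans (by norm_num) hm
    have h1 : (q⁻¹) ^ 2 ≤ 100 ^ 2 * t4 m := inv_sq_le_t4 h100 hm3 hqm
    have h2 : q⁻¹ * q⁻¹ ≤ w2 cL i * w2 cL j :=
      mul_le_mul (inv_le_w2_of_le hcL.1 hq1 hqi') (inv_le_w2_of_le hcL.1 hq1 hqj') hi0 (hwA i)
    have h3 := mul_le_mul h1 h2 (by positivity) (by have := t4_nonneg m; positivity)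
    calc (q⁻¹) ^ 2 * (q⁻¹ * q⁻¹) ≤ 100 ^ 2 * t4 m * (w2 cL i * w2 cL j) := h3
      _ = 100 ^ 2 * (w2 cL i * (w2 cL j * t4 m)) := by ring
      _ ≤ _ := by linarith

/-- **Far-field domination (two-sided):** `|TfarL| ≤ BL` termwise. [folklore] -/
theorem abs_TfarL_le_BL (n : ℤ × ℤ × ℤ) : |TfarL n| ≤ BL n := by
  obtain ⟨i, j, m⟩ := n
  obtain ⟨hB1, hB2, hB3⟩ := BL_parts_nonneg (i, j, m)
  dsimp only at hB1 hB2 hB3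
  show |TfarL (i, j, m)| ≤ 8 * (cL ^ 2 * (t4 i * (w2 cL j * w2 100 m)) +
      cL ^ 2 * (w2 cL i * (t4 j * w2 100 m)) + 100 ^ 2 * (w2 cL i * (w2 cL j * t4 m)))
  unfold TfarL
  by_cases h : ((i, j, m) : ℤ × ℤ × ℤ) = 0 ∨ ((i, j, m) : ℤ × ℤ × ℤ) ∈ blockL
  · rw [if_pos h, abs_zero]; linarith
  rw [if_neg h]
  push Not at h
  obtain ⟨hn0, hnb⟩ := h
  have hout : 3 ≤ |i| ∨ 3 ≤ |j| ∨ 10 ≤ |m| := by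
    by_contra hc
    push Not at hc
    obtain ⟨hi, hj, hm⟩ := hc
    rw [abs_lt] at hi hj hm
    apply hnb
    simp only [blockL, Finset.mem_erase, Finset.mem_product, Finset.mem_Icc]
    exact ⟨hn0, ⟨by omega, by omega⟩, ⟨by omega, by omega⟩, by omega, by omega⟩
  have hY : YL (i, j, m) ≠ 0 := YL_ne_zero hn0
  rw [hx, if_neg hY, Hess₀_ex₁_eq hY]
  obtain ⟨-, -, -, ⟨hp0, hpq⟩, h1⟩ := slabL_bounds i j m
  have hq1 := h1 hout
  obtain ⟨hup, hlo⟩ := TQ_abs_bounds hp0 hpq hq1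
  have hsl := inv_pow_four_le_slabsL hout
  have h4 : 0 ≤ ((‖YL (i, j, m)‖ ^ 2)⁻¹) ^ 4 := by positivity
  rw [abs_le]
  constructor <;> nlinarith

/-- The majorant is summable with an explicit sum. [folklore] -/
theorem hasSum_BL : HasSum BL
    (8 * (cL ^ 2 * ((∑' n, t4 n) * ((∑' n, w2 cL n) * ∑' n, w2 100 n)) +
      cL ^ 2 * ((∑' n, w2 cL n) * ((∑' n, t4 n) * ∑' n, w2 100 n)) +
      100 ^ 2 * ((∑' n, w2 cL n) * ((∑' n, w2 cL n) * ∑' n, t4 n)))) := by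
  have hA := summable_norm_w2 cL
  have hH := summable_norm_w2 100
  exact ((((hasSum_mul3 summable_norm_t4 hA hH).mul_left _).add
    ((hasSum_mul3 hA summable_norm_t4 hH).mul_left _)).add
    ((hasSum_mul3 hA hA summable_norm_t4).mul_left _)).mul_left 8

/-- **The far field is at most `10⁶`** (against a near field below `−4·10⁷`). [folklore] -/
theorem tsum_BL_le : ∑' n, BL n ≤ 1000000 := by
  rw [hasSum_BL.tsum_eq]
  have hcL := cL_pos_inv
  have ht := tsum_t4_le
  have ht0 : 0 ≤ ∑' n, t4 n := tsum_nonneg t4_nonneg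
  have hwA := tsum_w2_le hcL.1.le
  have hwH := tsum_w2_le (show (0 : ℝ) ≤ 100 by norm_num)
  have hwA0 : 0 ≤ ∑' n, w2 cL n := tsum_nonneg (w2_nonneg hcL.1.le)
  have hwH0 : 0 ≤ ∑' n, w2 100 n := tsum_nonneg (w2_nonneg (show (0 : ℝ) ≤ 100 by norm_num))
  have hc : cL ≤ 34 / 10 := by unfold cL a₀; norm_num
  have hc0 := hcL.1.le
  set T := ∑' n, t4 n
  set WA := ∑' n, w2 cL n
  set WH := ∑' n, w2 (100 : ℝ) n
  have hWA : WA ≤ 123 / 10 := by nlinarith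
  have hWH : WH ≤ 332 := by linarith
  have h1 : cL ^ 2 * (T * (WA * WH)) ≤ (34 / 10) ^ 2 * (63 / 1000 * (123 / 10 * 332)) := by
    gcongr
  have h2 : cL ^ 2 * (WA * (T * WH)) ≤ (34 / 10) ^ 2 * (123 / 10 * (63 / 1000 * 332)) := by
    gcongr
  have h3 : (100 : ℝ) ^ 2 * (WA * (WA * T)) ≤ 100 ^ 2 * (123 / 10 * (123 / 10 * (63 / 1000))) := by
    gcongr
  linarith

/-! ### Summability of the row function and the sign of the second variation -/

/-- The far part is absolutely summable. [folklore] -/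
theorem summable_TfarL : Summable TfarL :=
  Summable.of_norm_bounded hasSum_BL.summable fun n => by
    rw [Real.norm_eq_abs]; exact abs_TfarL_le_BL n

/-- The full row function of the squashed lattice is summable over the sheared labels. [folklore] -/
theorem summable_hx_YL : Summable fun n : ℤ × ℤ × ℤ => hx (YL n) := by
  obtain ⟨S, hS, -⟩ := hasSum_TnearL
  exact (hS.summable.add summable_TfarL).congr fun n => (hx_eq_addL n).symm

/-- **The second variation of `e₁·𝟙_{0}` on the squashed fcc lattice is negative:**
`Σ'_n e₁ᵀK(YL n)e₁ < −4·10⁷ + 10⁶ < 0`. [folklore] -/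
theorem tsum_hx_YL_neg : ∑' n : ℤ × ℤ × ℤ, hx (YL n) < 0 := by
  obtain ⟨S, hS, hSlt⟩ := hasSum_TnearL
  have hsplit : ∑' n : ℤ × ℤ × ℤ, hx (YL n) = S + ∑' n, TfarL n := by
    rw [← hS.tsum_eq, ← hS.summable.tsum_add summable_TfarL]
    exact tsum_congr hx_eq_addL
  have hle : ∑' n, TfarL n ≤ ∑' n, BL n :=
    Summable.tsum_le_tsum (fun n => (le_abs_self _).trans (abs_TfarL_le_BL n)) summable_TfarL
      hasSum_BL.summable
  linarith [tsum_BL_le]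

/-- The lattice row of `e₁` on the squashed fcc lattice is summable (transport of
`summable_hx_YL` along the sheared labelling). [folklore] -/
theorem summable_Hrow_fccLat_sq :
    Summable (Hrow (fccLat a₀_ne_zero hSq_ne_zero_pos.1) ex₁) := by
  set L := fccLat a₀_ne_zero hSq_ne_zero_pos.1
  let φ : ℤ × ℤ × ℤ → L := fun n => ⟨YL n, YL_mem n⟩
  have hφ : Function.Injective φ := fun n n' h =>
    YL_injective (congrArg (fun y : L => (y : E3)) h)
  have hrange : ∀ y : L, y ∉ Set.range φ → Hrow L ex₁ y = 0 := by
    intro y hy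
    obtain ⟨n, hn⟩ := exists_YL_eq y.2
    exact (hy ⟨n, Subtype.ext hn⟩).elim
  have hcomp : Hrow L ex₁ ∘ φ = fun n => hx (YL n) := by
    funext n
    simp only [Function.comp, Hrow, hx, φ, Submodule.mk_eq_zero]
  exact (hφ.summable_iff hrange).1 (hcomp ▸ summable_hx_YL)

/-- Reindexing the lattice row sum by sheared labels. [folklore] -/
theorem tsum_Hrow_fccLat_sq_eq :
    ∑' y : fccLat a₀_ne_zero hSq_ne_zero_pos.1, Hrow (fccLat a₀_ne_zero hSq_ne_zero_pos.1) ex₁ y =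
      ∑' n : ℤ × ℤ × ℤ, hx (YL n) := by
  set L := fccLat a₀_ne_zero hSq_ne_zero_pos.1
  let φ : ℤ × ℤ × ℤ → L := fun n => ⟨YL n, YL_mem n⟩
  have hφ : Function.Injective φ := fun n n' h =>
    YL_injective (congrArg (fun y : L => (y : E3)) h)
  have hsupp : Function.support (Hrow L ex₁) ⊆ Set.range φ := by
    intro y _
    obtain ⟨n, hn⟩ := exists_YL_eq y.2
    exact ⟨n, Subtype.ext hn⟩
  rw [← hφ.tsum_eq hsupp]
  refine tsum_congr fun n => ?_
  simp only [Hrow, hx, φ, Submodule.mk_eq_zero]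

/-- **The lower height bound is load-bearing.**  On the window `47/50 ≤ a ≤ 1 ∧ IsHaggSeq s ∧
0 < z(m+1) − z(m) ≤ 17a/20` (the crux's `Box` with the LOWER bound `39a/50 ≤ z(m+1) − z(m)`
deleted, keeping strictly increasing heights) uniform polytype stability FAILS: the fcc word at
`a = 47/50` with uniform SQUASHED spacing `h = 1/10` is in the window and force balanced (a
Bravais lattice, part I), and its third-neighbour layers — same registry `A` — sit straight above
each other at distance `3h = 0.3`; for `u = e₁·𝟙_{0}` these two bonds contribute the tangential
prestress `2V′(3h)/(3h) ≈ −5·10⁸` to `½·hessForm = Σ_{y≠0} e₁ᵀK(y)e₁`, against `≈ +3·10⁶` from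
everything else (near block of 474 vectors exact over `ℚ` by the kernel: `< −4·10⁷` in the file's
`V/12` units; far field `|T| ≤ 8q⁻⁴ ≤` three slab majorants in SHEARED labels
`(i, j, m) ↦ i u + j v + l(m) w + m h e₃`, `l(m) ∈ {−1,0,1}`, summed with `ζ(2)`, `ζ(4)`:
`≤ 10⁶`), so `½·hessForm < 0 ≤ κ·nnForm`.  (The disprover's Bloch scan shows the statement is
in fact false already at `h = 0.66a` through an EXTENDED shear mode; the single-site witness needs
`h ≲ 0.15`.) [folklore] -/
theorem uniformPolytypeStability_false_without_heightLower :
    ¬ UniformPolytypeStabilityOn fun a s z => 47 / 50 ≤ a ∧ a ≤ 1 ∧ IsHaggSeq s ∧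
      ∀ m : ℤ, 0 < z (m + 1) - z m ∧ z (m + 1) - z m ≤ 17 / 20 * a := by
  rintro ⟨κ, hκ, h⟩
  set L := fccLat a₀_ne_zero hSq_ne_zero_pos.1
  have hS : Sites a₀ constHagg (zU hSq) = (L : Set E3) := sites_const_zU a₀_ne_zero hSq_ne_zero_pos.1
  have hW : 47 / 50 ≤ a₀ ∧ a₀ ≤ 1 ∧ IsHaggSeq constHagg ∧
      ∀ m : ℤ, 0 < zU hSq (m + 1) - zU hSq m ∧ zU hSq (m + 1) - zU hSq m ≤ 17 / 20 * a₀ := by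
    refine ⟨by unfold a₀; norm_num, by unfold a₀; norm_num, isHaggSeq_const, fun m => ?_⟩
    rw [zU_succ_sub]; unfold hSq a₀; norm_num
  have hF : ForceBalanced a₀ constHagg (zU hSq) :=
    forceBalanced_of_sites_eq L (finrank_fccLat _ _) hS
  have hsupp : Function.support (uS ex₁) ⊆ Sites a₀ constHagg (zU hSq) :=
    (support_uS ex₁).trans (by
      intro p hp
      rw [Set.mem_singleton_iff] at hp
      subst hp
      rw [hS]
      exact L.zero_mem)
  have key := h a₀ constHagg (zU hSq) hW hF (uS ex₁) (finite_support_uS ex₁) hsupp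
  rw [hessForm_single_of_summable L hS summable_Hrow_fccLat_sq, tsum_Hrow_fccLat_sq_eq] at key
  have hnn := mul_nonneg hκ.le (nnForm_nonneg a₀ constHagg (zU hSq) (uS ex₁))
  linarith [tsum_hx_YL_neg]

end HeightLower

end HeightLowerPart

end Summit.AtomisticToContinuum.Crystallization.Cruxes.UniformPolytypeStability.Disproof

end

noncomputable section

namespace Summit.AtomisticToContinuum.Crystallization.Cruxes.UniformPolytypeStability.Disproof

open scoped BigOperators Topology Classical InnerProductSpace
open Filter Set Function
open Literature.MathematicalPhysics.StatisticalMechanics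
open Summit.AtomisticToContinuum.Crystallization.Theorems.PhononStabilityNegative

local notation "E3" => EuclideanSpace ℝ (Fin 3)

/-! ## Part IV — Numerics: the crux resists; where it is decided; which hypotheses matter (workfile only)

Codes (disprover folder, attached as item evidence): `py/fcc_scan.py`, `py/fcc_longwave.py`
(pure python, fcc 1-atom cell, exact long-wave pencil), `py/poly_pure.py` (pure python N-layer
pencil, validation), `polyscan/blochlib.py` + `main.py` (numpy/scipy; kit job **j026689**, node
cmp-10, 1142 s, evidence `compute-j026689.json` on the item).  Per Bloch mode the typed inequality
reads `ratio(k) = v†D(k)v / (2 v†N(k)v)` with `v†Dv = ½ΣΣ Hess` per cell and `v†Nv = ½ΣΣ_{NN}|Δu|²`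
per cell; the crux holds on a given `L(a,s,z)` iff `inf_k λ_gen ≥ κ`.  Lattice sums to `r ≤ 6–7.5`
(tails move ratios `< 1e-3`).  Validation: `D(0)` annihilates translations (`3e-15`), Hermitian to
`0`; 1-layer fcc cell = explicit 3-layer ABC cell at the global minimum; pure-python and numpy codes
agree (`0.1817` vs `0.1813` at the worst corner); relaxed value `0.465` reproduces the sibling crux
9333's independent codes (`0.466`); numerical force-balance residuals `≤ 1e-13` at uniform gaps
for EVERY tested word (fcc, hcp, dhcp, 6H, 9R, 15R, 4|1, twin8, two random words).

RESULTS (force-balanced gaps; min over `k` of `λ_gen`; rows `a`, columns `h/a`):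
```
fcc     .78    .80    .8165  .83    .85        hcp     .78    .80    .8165  .83    .85
0.940  .798   .803   .762   .668   .496       0.940  .798   .803   .762   .700   .582
0.955  .624   .628   .595   .522   .386       0.955  .625   .629   .595   .546   .452
0.970  .489   .492   .465   .407   .301       0.970  .489   .492   .465   .426   .350
0.985  .383   .385   .364   .318   .234       0.985  .383   .385   .364   .332   .271
1.000  .300   .302   .285   .248   .181 ←MIN  1.000  .300   .302   .285   .259   .209
```
(dhcp and 6H coincide with hcp to `±0.005`; mixed words lie BETWEEN fcc and hcp according to their
cubic-layer content — worst per word at `(1, .85a)`: fcc .181, twin8 .192, 4|1 .194, 9R .202,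
6H .204, 15R .206, rand12 .206, rand7 .207, hcp/dhcp .209; at `(.94, .85a)`: fcc .496, twin8
.536, 4|1 .538, 9R .563, 15R .574, hcp .582.  The fcc word is the extremal polytype.)  The minimum is ALWAYS long-wave
acoustic (`|k| → 0`), i.e. loss of margin in the prestressed elasticity tensor under biaxial+c-axis
TENSION (stress `(σ_xx, σ_zz) = (+0.57, +0.83)` at the worst corner vs `(−0.04,−0.04)` relaxed);
no optical / zone-boundary pocket and no word-specific soft branch ("near-degenerate optical modes
of long-period words" do not occur: the word enters only through second-layer terms, `±2 %`).

WITHOUT FORCE BALANCE — exhaustive corner scan (job **j026943**, 165 s: ALL `2^N` gap patterns in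
`{.78a, .85a}^N` up to cyclic symmetry, `N ∈ {2,3,4,6}`, words fcc / hcp / mixed, `a ∈ {.94,.97,1}`,
plus the earlier 90 random/one-off patterns of j026689 with dhcp/9R/rand7): `min = 0.1535` (hcp
word, gaps `.78a/.85a` alternating, `a = 1`; fcc `.1571` same pattern; every `a = .97` datum
`≥ .2483`, every `a = .94` datum `≥ .42`), i.e. the UNRELAXED family is still uniformly stable and
the worst case is again `a = 1` with as many `.85a` gaps as the alternation allows.  ⇒ For the
provers: the force-balance hypothesis is (numerically) NOT load-bearing — `stub_nearField` may be
proved for ALL `z` in the height box, which removes the need to parametrise the force-balance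
manifold; it costs ≈ 15 % of the constant (aim `κ ≤ 0.07`, half the unrelaxed optimum, or
`κ ≤ 0.09` with force balance).

TIGHTNESS / THRESHOLDS (uniform fcc | hcp, outside the box):
`a = 1`: `h/a = .88 → +.084 | +.094`, `.90 → +.031 | +.036`, `.92 → −.012 | −.008` (edge .85);
`h = .85a`: `a = 1.02 → +.129 | +.147`, `1.04 → +.091 | +.103`, `1.05 → +.039 | +.054`,
`1.06 → −.028 | −.017` (edge 1.0); `h = .8165a`: `a = 1.06 → +.105`, `1.08 → −.015 | +.020`;
compressed side `a = .94`: `h/a = .74 → +.61`, `.70 → +.18`, `.66 → −.60` (edge .78);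
`a = .90, .85` at ideal ratio: `+1.5, +3.5`.  So the UPPER edges `a ≤ 1`, `h ≤ .85a` sit within
`≈ 6 %` of a genuine harmonic (elastic shear) instability of all-tensile LJ close packings; the lower
edges are far (`≥ 11 %`).  "Shrink the box" repairs have room only at the top; any enlargement of
the window of `LayeredWindows`/`BarlowLiouville` beyond `a ≈ 1.05` or `h ≈ 0.91a` loses K4.
-/

/-! ## Part V — Near-misses and refuted strengthenings (workfile only; `sorry` = no Lean proof) -/

/- The former NEAR-MISS `uniformPolytypeStability_false_without_heightLower` (lower height bound) is
now PROVED: Part V″ above (squashed fcc, `h = 1/10`, single-site witness; the earlier verdict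
"single-site witness refuted" held only for `h ≥ 0.2` — j026943/B3 did not scan below — the
collinear prestress `2V′(3h)/(3h) ∼ −(3h)⁻¹⁴` overtakes the adjacent-layer stiffness `∼ h⁻¹` at
`h ≈ 0.15`). -/

/-- REFUTED STRENGTHENING (numerically FALSE, no Lean proof): the crux with the spacing window
enlarged to `a ≤ 53/50 = 1.06`.  At `(a, h) = (1.06, .85a)` uniform fcc / hcp (force balanced) the
long-wave generalized Bloch eigenvalue is `−0.028 / −0.017` (job j026689, Part IV): the prestressed
acoustic tensor of all-tensile LJ close packing loses strong ellipticity between `a = 1.05` and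
`1.06`.  Obstruction to a Lean proof: certifying the SIGN of an infinite lattice-sum quadratic
form with margin `3e-2` against `r⁻⁸` tails (interval arithmetic + an enveloped-wave witness of
~10⁴ sites) — the same machinery as the crux itself.  Recorded so that nobody files `a ≤ 1.06`
(or a matching tolerance translating to it) as a repair.  [folklore] -/
theorem not_uniformPolytypeStabilityOn_a_le_106 :
    ¬ UniformPolytypeStabilityOn fun a s z => 47 / 50 ≤ a ∧ a ≤ 53 / 50 ∧ IsHaggSeq s ∧
      HeightBox a z := by
  sorry

/-- REFUTED STRENGTHENING (numerically FALSE, no Lean proof): the crux with the height window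
enlarged to `[39a/50, 23a/25]` (`h ≤ 0.92a`).  At `(a, h) = (1, .92a)` uniform fcc / hcp the
long-wave generalized eigenvalue is `−0.012 / −0.008` (Part IV; `+0.031/+0.036` at `.90a`).
Same obstruction as above.  [folklore] -/
theorem not_uniformPolytypeStabilityOn_h_le_092 :
    ¬ UniformPolytypeStabilityOn fun a s z => 47 / 50 ≤ a ∧ a ≤ 1 ∧ IsHaggSeq s ∧
      ∀ m : ℤ, 39 / 50 * a ≤ z (m + 1) - z m ∧ z (m + 1) - z m ≤ 23 / 25 * a := by
  sorry

/-- POSSIBLY UNNECESSARY HYPOTHESIS (numerical evidence only, Part IV): the crux WITHOUT the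
force-balance hypothesis — stability for ALL height sequences in the box.  Worst tested datum
`0.153 > 0` (hcp word, alternating gaps `.78a/.85a`, `a = 1`); a proof of this stronger statement
would discharge the crux by `UniformPolytypeStabilityOn.mono`-style monotonicity and spares the
prover the parametrisation of force-balanced `z`.  Stated positively, so NOT a Negative-lane item;
recorded here as the disprover's recommendation for `stub_nearField`.  [folklore] -/
theorem uniformPolytypeStability_without_forceBalance_conjecture :
    ∃ κ : ℝ, 0 < κ ∧ ∀ (a : ℝ) (s : ℤ → ℤ) (z : ℤ → ℝ), Box a s z →
      ∀ u : E3 → E3, (Function.support u).Finite → Function.support u ⊆ Sites a s z →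
        κ * nnForm a s z u ≤ hessForm a s z u / 2 := by
  sorry

end Summit.AtomisticToContinuum.Crystallization.Cruxes.UniformPolytypeStability.Disproof

end
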